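import Literature.Algebra.EuclideanLattices.GapCVPPrime
import Literature.Computability.Complexity.StackBricks
import Literature.Computability.Complexity.StackUnary
import Literature.Computability.Complexity.EncodingFrames
import Literature.Computability.Complexity.BranchingFn
import HarnessLib

/-!
# The GMSS step function is polynomial-time: discharge of `gmssAlg_isPolyTime`

Topic `Algebra/EuclideanLattices` (family `pqc`), sibling proof file of `GapCVPPrime.lean`
(D-0014: the named fact `Literature.PQC.gmssAlg_isPolyTime : Prop` stays a `def` there and is
discharged here as `Literature.Algebra.EuclideanLattices.gmssAlg_isPolyTime_holds`). With it, Micciancio–Regev 2007,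
Lemma 5.22 (= Goldreich–Micciancio–Safra–Seifert 1999, Thm. 1) is a Cook reduction of promise
problems `GapSVP_γ → GapCVP′_γ` with NO remaining hypothesis
(`gapSVP_cookReducible_gapCVP'_holds`), and one of the four leaves of
`owfExist_of_gapSVP_worstCaseHard` (`Cryptography/LatticeOWFProofs.lean`) is closed.

**What is proved.** `gmssAlg.IsPolyTime encodingBoolBool`: the step function of the GMSS
oracle algorithm, as a function of the `boolPair`-coded pair (input `x`, transcript code `T`)
with the tagged output code (`Encoding.sumBool`), is computed by a polynomial-time machine. The
step is the syntactic function `GMSS.gcore x T` of `GapCVPPrime.lean` (total on all strings), so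
the machine has to agree with it on EVERY `x` and `T`, not only on codes of instances.

**Method** (no Turing machine is written by hand; Arora–Barak 2009, §1.3: polynomial time is
closed under composition and case distinction). The string function
`gFn = iteFn c₁ (const 11) (iteFn c₂ (const 11) (iteFn c₃ (const 10) q))` (`BranchingFn.iteFn`)
is in `FP` as soon as the three one-bit tests `c₁ w = [dimOf x = 0]`, `c₂ w = [thas T]`,
`c₃ w = [dimOf x ≤ tlen T]` and the query writer `q w = 0 :: query x (tlen T) (dimOf x)` are, and
`gFn ⟨x, T⟩` is the code of `gcore x T` (`gFn_boolPair`); `PolyTimeComputable.of_encode` turns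
this into `OracleAlg.IsPolyTime` (`gmssAlg_isPolyTime_holds`). Each of the four functions is a
verified structured stack program (`Com`, `StackPrograms.lean`) over one register type `G`
(33 registers, contents handled as a record `GF` so that simulation lemmas mention only the
registers that change), packaged by `Brick.binOp_mem_FP` (`StackBricks.lean`: operands
`x`, `T` delivered by the verified pair decoder `unpairW`, result read off `out`, polynomial
budget). The programs are straight-line compositions of the tree's verified routines —
`unpairW` (exact `boolUnpair` on every string, `StackStrings.lean`), `pour`/`copy`/`clear`
(`StackArith.lean`), `dblReg`/`takeN`/`subFrom`/`addReg`/`mulReg`/`pourDbl` (`StackUnary.lean`),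
`pushN`/`runs_indexLoop`/`repBits` (`StackRoutines.lean`) — plus three more generic loops proved
here (`Com.pourRep`: pour repeating each bit `r` times; `Com.cntLoop`: count a register in unary
while moving it; `Com.onesOf`: normalise a counter to `1ⁿ`):

* prelude (`runs_prelude`, `≤ 200(|x|+1)²` steps): cap `K = 1^{|x|}` (`countK`), `x = ⟨li, er⟩`
  (`splitX`), `li = ⟨nc, mc⟩` (`splitLi`), and the saturating evaluation of the binary header
  `nc`, most significant bit first, `nU := 1^{min(2|nU|+b, |K|)}` per bit (`satBody`, `satLoop`,
  `satGo_reverse`: the loop computes `GMSS.satVal |x| nc = dimOf x`);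
* brick 1 (`runs_brick1`): `[nU = []]`; brick 2 (`runs_brick2`): split `T = ⟨U, body⟩`
  (`splitT`), scan `|U|` framed items of `body` raising a flag on an item `[true]` (`testE`,
  `hasBody`, `hasLoop`, `hasGo_eq`); brick 3 (`runs_brick3`): `nU ⇂ |U|` (`subFrom`) and
  `[nU = []]`;
* brick 4 (`runs_brick4`, `≤ 1000(|x|+|T|+1)³` steps): `j = |U|` in unary, `s = j·n`
  (`mulReg`), `mc = ⟨hm, ents⟩` (`splitMc`); emit `hm` doubled (`emitHm`); walk `s` framed
  entries re-emitting them doubled (`stepS`, `walkS`), then `n` entries emitting each as a doubled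
  `dblInt` code — sign fourfold, `0011`, the new low bit `00` unless the magnitude is `0`
  (`lowBit`), magnitude doubled, `01` — while copying the entry into the row buffer (`stepC1`,
  `stepC2`, `walkC`); append the unread tail; and assemble
  `0 · nc⁴ · 0011 · D⁴ · 0011 · (1ⁿ)⁴ · 0011 · Rw² · 01 · er` (`assemble`, `assembled_eq_query`: this
  flat string is `0 :: GMSS.query x j n`, by `boolPair_eq` and `repBits` algebra; the flat
  emissions `emitS`/`emitC` are `GMSS.dblEnts`/`GMSS.rowEnts`, `dblEnts_eq`, `rowEnts_eq`).

Relocation owed (librarian): `Com.pourRep`, `Com.cntLoop`, `Com.onesOf`, `Com.Runs.of_eq'`,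
`Com.dbl_eq_repBits` are generic and belong in `StackRoutines.lean` / `StackUnary.lean`.

## References

* D. Micciancio, O. Regev, *Worst-case to average-case reductions based on Gaussian measures*,
  SIAM J. Comput. 37 (2007); authors' full version, Lemma 5.22 (p. 27): "there is a polynomial
  time reduction from GapSVP_γ to GapCVP′_γ".
* O. Goldreich, D. Micciancio, S. Safra, J.-P. Seifert, *Approximating shortest lattice vectors
  is not harder than approximating closest lattice vectors*, IPL 71 (1999), Thm. 1 / §3.
* S. Arora, B. Barak, *Computational Complexity: A Modern Approach*, CUP 2009, §1.3 (machine
  constructions, polynomial time closed under composition), §0.1 (pairing of strings).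
* T. Nipkow, G. Klein, *Concrete Semantics with Isabelle/HOL*, Springer 2014, Ch. 7 (big-step
  semantics, loop invariants).
-/

noncomputable section

/-! ### Three more generic register routines -/

namespace Literature.Algebra.EuclideanLattices
section Com
open Literature.Computability.Complexity (Com)
open Literature.Computability.Complexity.Com

section Generic

variable {ι : Type} [DecidableEq ι]

/-- `pourRep k o r`: pour register `k` onto `o`, repeating each bit `r` times. [folklore] -/
def _root_.Literature.Computability.Complexity.Com.pourRep (k o : ι) (r : ℕ) : Com ι := loop k (pushN o true r) (pushN o false r)

/-- **Effect of `pourRep`** (cost `(r + 2)|k| + 1`): `o := repBits r (reverse k) ++ o`, `k := []`.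
[folklore] -/
theorem _root_.Literature.Computability.Complexity.Com.runs_pourRep {k o : ι} (hk : k ≠ o) (r : ℕ) : ∀ (w : List Bool) (R : Literature.Computability.Complexity.Regs ι), R k = w →
    Runs (pourRep k o r) R (Function.update (Function.update R k []) o (repBits r w.reverse ++ R o))
      ((r + 2) * w.length + 1)
  | [], R, hR => by
    refine (Runs.loop_nil _ _ hR).of_eq ?_ (by simp)
    ext i : 1
    simp only [Function.update_apply, List.reverse_nil, repBits_nil, List.nil_append]
    split_ifs <;> simp_all
  | b :: w, R, hR => by
    have hbody : ∀ c : Bool, Runs (pushN o c r) (Function.update R k w)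
        (Function.update (Function.update R k w) o (List.replicate r c ++ R o)) r := by
      intro c
      refine (runs_pushN o c r _).of_eq ?_ le_rfl
      rw [Function.update_of_ne hk.symm]
    have ih : ∀ c : Bool, Runs (pourRep k o r) (Function.update (Function.update R k w) o (List.replicate r c ++ R o))
        (Function.update (Function.update R k []) o (repBits r (c :: w).reverse ++ R o))
        ((r + 2) * w.length + 1) := by
      intro c
      refine (runs_pourRep hk r w _ (by rw [Function.update_of_ne hk, Function.update_self])).of_eq ?_ le_rfl
      ext i : 1
      simp only [Function.update_apply, List.reverse_cons, repBits_append, repBits_cons, repBits_nil,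
        List.append_nil, List.append_assoc]
      split_ifs <;> simp_all
    rw [show (r + 2) * (b :: w).length + 1 = r + 2 + ((r + 2) * w.length + 1) by simp; ring]
    cases b
    · exact Runs.loop_false hR (hbody false) (ih false)
    · exact Runs.loop_true hR (hbody true) (ih true)

/-- `cntLoop k t K`: move `k` onto `t` (reversed) and push one `true` onto `K` per bit. [folklore] -/
def _root_.Literature.Computability.Complexity.Com.cntLoop (k t K : ι) : Com ι := loop k (push t true ;; push K true) (push t false ;; push K true)

/-- **Effect of `cntLoop`** (cost `4|k| + 1`): `t := reverse k ++ t`, `K := 1^{|k|} ++ K`, `k := []`.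
[folklore] -/
theorem _root_.Literature.Computability.Complexity.Com.runs_cntLoop {k t K : ι} (hkt : k ≠ t) (hkK : k ≠ K) (htK : t ≠ K) : ∀ (w : List Bool) (R : Literature.Computability.Complexity.Regs ι),
    R k = w → Runs (cntLoop k t K) R
      (Function.update (Function.update (Function.update R k []) t (w.reverse ++ R t)) K (Literature.Computability.Complexity.ones w.length ++ R K))
      (4 * w.length + 1)
  | [], R, hR => by
    refine (Runs.loop_nil _ _ hR).of_eq ?_ (by simp)
    ext i : 1
    simp only [Function.update_apply, List.reverse_nil, List.nil_append, List.length_nil, Literature.Computability.Complexity.ones]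
    split_ifs <;> simp_all
  | b :: w, R, hR => by
    have hbody : ∀ c : Bool, Runs (push t c ;; push K true) (Function.update R k w)
        (Function.update (Function.update (Function.update R k w) t (c :: R t)) K (true :: R K)) (1 + 1) := by
      intro c
      refine ((Runs.push t c _).seq (Runs.push K true _)).of_eq ?_ le_rfl
      simp [Function.update_of_ne hkt.symm, Function.update_of_ne hkK.symm, Function.update_of_ne htK.symm]
    have ih : ∀ c : Bool, Runs (cntLoop k t K)
        (Function.update (Function.update (Function.update R k w) t (c :: R t)) K (true :: R K))
        (Function.update (Function.update (Function.update R k []) t ((c :: w).reverse ++ R t)) K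
          (Literature.Computability.Complexity.ones (c :: w).length ++ R K)) (4 * w.length + 1) := by
      intro c
      refine (runs_cntLoop hkt hkK htK w _ (by simp [Function.update_of_ne hkK, Function.update_of_ne hkt])).of_eq ?_ le_rfl
      ext i : 1
      simp only [Function.update_apply, List.reverse_cons, List.append_assoc, List.singleton_append,
        List.length_cons, Literature.Computability.Complexity.ones, List.replicate_succ']
      split_ifs <;> simp_all
    rw [show 4 * (b :: w).length + 1 = 1 + 1 + 2 + (4 * w.length + 1) by simp; ring]
    cases b
    · exact Runs.loop_false hR (hbody false) (ih false)
    · exact Runs.loop_true hR (hbody true) (ih true)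

/-- `onesOf k u`: push one `true` onto `u` per bit of `k` (normalising a counter to `1ⁿ`),
emptying `k`. [folklore] -/
def _root_.Literature.Computability.Complexity.Com.onesOf (k u : ι) : Com ι := loop k (push u true) (push u true)

/-- **Effect of `onesOf`** (cost `3|k| + 1`): `u := 1^{|k|} ++ u`, `k := []`. [folklore] -/
theorem _root_.Literature.Computability.Complexity.Com.runs_onesOf {k u : ι} (hku : k ≠ u) : ∀ (w : List Bool) (R : Literature.Computability.Complexity.Regs ι), R k = w →
    Runs (onesOf k u) R (Function.update (Function.update R k []) u (Literature.Computability.Complexity.ones w.length ++ R u)) (3 * w.length + 1)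
  | [], R, hR => by
    refine (Runs.loop_nil _ _ hR).of_eq ?_ (by simp)
    ext i : 1
    simp only [Function.update_apply, List.length_nil, Literature.Computability.Complexity.ones, List.replicate_zero, List.nil_append]
    split_ifs <;> simp_all
  | b :: w, R, hR => by
    have hbody : Runs (push u true) (Function.update R k w)
        (Function.update (Function.update R k w) u (true :: R u)) 1 := by
      refine (Runs.push u true _).of_eq ?_ le_rfl
      rw [Function.update_of_ne hku.symm]
    have ih : Runs (onesOf k u) (Function.update (Function.update R k w) u (true :: R u))
        (Function.update (Function.update R k []) u (Literature.Computability.Complexity.ones (b :: w).length ++ R u)) (3 * w.length + 1) := by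
      refine (runs_onesOf hku w _ (by simp [Function.update_of_ne hku])).of_eq ?_ le_rfl
      ext i : 1
      simp only [Function.update_apply, List.length_cons, Literature.Computability.Complexity.ones, List.replicate_succ', List.append_assoc,
        List.singleton_append]
      split_ifs <;> simp_all
    rw [show 3 * (b :: w).length + 1 = 1 + 2 + (3 * w.length + 1) by simp; ring]
    cases b
    · exact Runs.loop_false hR hbody ih
    · exact Runs.loop_true hR hbody ih

/-- Re-targeting a run along equalities of both register files and a larger budget. [folklore] -/
theorem _root_.Literature.Computability.Complexity.Com.Runs.of_eq' {c : Com ι} {R R₀ R₁ R' : Literature.Computability.Complexity.Regs ι} {B₁ B : ℕ} (h : Runs c R R₁ B₁) (hR₀ : R = R₀)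
    (hR : R₁ = R') (hB : B₁ ≤ B) : Runs c R₀ R' B :=
  hR₀ ▸ h.of_eq hR hB

end Generic

/-- The bit doubling of `StackMachines.lean` is `repBits 2`. [folklore] -/
theorem _root_.Literature.Computability.Complexity.Com.dbl_eq_repBits (w : List Bool) : Literature.Computability.Complexity.SProg.dbl w = repBits 2 w := by
  induction w with
  | nil => rfl
  | cons b w ih => simp [ih, repBits_cons, List.replicate]

end Com
end Literature.Algebra.EuclideanLattices

/-! ## The machine -/

namespace Literature.Algebra.EuclideanLattices.GMSSMachine

open _root_.Computability Literature.Computability.Complexity Literature.Computability.Complexity.Com GMSS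

/-- Length of a unary string. [folklore] -/
@[simp] theorem length_ones (n : ℕ) : (ones n).length = n := List.length_replicate

/-! ### The registers -/

/-- The registers of the GMSS step machine: the two operands (`x`, `tr`), the output, the pair
decoder's targets and mode (`A`, `Tt`, `M`, `P`), the cap `K`, the parsed pieces of the input
(`li`, `er`, `nk`, `nc`, `mc`, `hm`, `ents`), the unary dimension and its copy (`nU`, `nV`), the
unary round count (`jU`), entry buffers (`e`, `e2`, `e3`, `sg`), loop counters (`sU`, `cU`, `q`),
staging and output buffers (`d`, `rD`, `rRow`, `d2`, `rO`), a flag `fl` and two scratch registers.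
[folklore] -/
inductive G where
  | x | tr | out | A | Tt | M | P | K | li | er | nk | nc | mc | hm | ents | nU | nV | jU | e | e2 | e3 | sg | sU | cU | q | d | rD | rRow | d2 | rO | fl | t1 | t2
  deriving DecidableEq, Fintype, Repr

/-- Contents of the registers, as a record (so that simulation lemmas mention only the
registers that change, via record update). [folklore] -/
structure GF where
  /-- register `x` -/
  x : List Bool := []
  /-- register `tr` -/
  tr : List Bool := []
  /-- register `out` -/
  out : List Bool := []
  /-- register `A` -/
  A : List Bool := []
  /-- register `Tt` -/
  Tt : List Bool := []
  /-- register `M` -/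
  M : List Bool := []
  /-- register `P` -/
  P : List Bool := []
  /-- register `K` -/
  K : List Bool := []
  /-- register `li` -/
  li : List Bool := []
  /-- register `er` -/
  er : List Bool := []
  /-- register `nk` -/
  nk : List Bool := []
  /-- register `nc` -/
  nc : List Bool := []
  /-- register `mc` -/
  mc : List Bool := []
  /-- register `hm` -/
  hm : List Bool := []
  /-- register `ents` -/
  ents : List Bool := []
  /-- register `nU` -/
  nU : List Bool := []
  /-- register `nV` -/
  nV : List Bool := []
  /-- register `jU` -/
  jU : List Bool := []
  /-- register `e` -/
  e : List Bool := []
  /-- register `e2` -/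
  e2 : List Bool := []
  /-- register `e3` -/
  e3 : List Bool := []
  /-- register `sg` -/
  sg : List Bool := []
  /-- register `sU` -/
  sU : List Bool := []
  /-- register `cU` -/
  cU : List Bool := []
  /-- register `q` -/
  q : List Bool := []
  /-- register `d` -/
  d : List Bool := []
  /-- register `rD` -/
  rD : List Bool := []
  /-- register `rRow` -/
  rRow : List Bool := []
  /-- register `d2` -/
  d2 : List Bool := []
  /-- register `rO` -/
  rO : List Bool := []
  /-- register `fl` -/
  fl : List Bool := []
  /-- register `t1` -/
  t1 : List Bool := []
  /-- register `t2` -/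
  t2 : List Bool := []

namespace GF

/-- A record of register contents as a register file. [folklore] -/
def get (F : GF) : Regs G
  | .x => F.x
  | .tr => F.tr
  | .out => F.out
  | .A => F.A
  | .Tt => F.Tt
  | .M => F.M
  | .P => F.P
  | .K => F.K
  | .li => F.li
  | .er => F.er
  | .nk => F.nk
  | .nc => F.nc
  | .mc => F.mc
  | .hm => F.hm
  | .ents => F.ents
  | .nU => F.nU
  | .nV => F.nV
  | .jU => F.jU
  | .e => F.e
  | .e2 => F.e2
  | .e3 => F.e3
  | .sg => F.sg
  | .sU => F.sU
  | .cU => F.cU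
  | .q => F.q
  | .d => F.d
  | .rD => F.rD
  | .rRow => F.rRow
  | .d2 => F.d2
  | .rO => F.rO
  | .fl => F.fl
  | .t1 => F.t1
  | .t2 => F.t2

section Lemmas

variable (F : GF) (v : List Bool)

/-- Reading `x`. [folklore] -/ @[simp] theorem get_x : F.get .x = F.x := rfl
/-- Reading `tr`. [folklore] -/ @[simp] theorem get_tr : F.get .tr = F.tr := rfl
/-- Reading `out`. [folklore] -/ @[simp] theorem get_out : F.get .out = F.out := rfl
/-- Reading `A`. [folklore] -/ @[simp] theorem get_A : F.get .A = F.A := rfl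
/-- Reading `Tt`. [folklore] -/ @[simp] theorem get_Tt : F.get .Tt = F.Tt := rfl
/-- Reading `M`. [folklore] -/ @[simp] theorem get_M : F.get .M = F.M := rfl
/-- Reading `P`. [folklore] -/ @[simp] theorem get_P : F.get .P = F.P := rfl
/-- Reading `K`. [folklore] -/ @[simp] theorem get_K : F.get .K = F.K := rfl
/-- Reading `li`. [folklore] -/ @[simp] theorem get_li : F.get .li = F.li := rfl
/-- Reading `er`. [folklore] -/ @[simp] theorem get_er : F.get .er = F.er := rfl
/-- Reading `nk`. [folklore] -/ @[simp] theorem get_nk : F.get .nk = F.nk := rfl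
/-- Reading `nc`. [folklore] -/ @[simp] theorem get_nc : F.get .nc = F.nc := rfl
/-- Reading `mc`. [folklore] -/ @[simp] theorem get_mc : F.get .mc = F.mc := rfl
/-- Reading `hm`. [folklore] -/ @[simp] theorem get_hm : F.get .hm = F.hm := rfl
/-- Reading `ents`. [folklore] -/ @[simp] theorem get_ents : F.get .ents = F.ents := rfl
/-- Reading `nU`. [folklore] -/ @[simp] theorem get_nU : F.get .nU = F.nU := rfl
/-- Reading `nV`. [folklore] -/ @[simp] theorem get_nV : F.get .nV = F.nV := rfl
/-- Reading `jU`. [folklore] -/ @[simp] theorem get_jU : F.get .jU = F.jU := rfl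
/-- Reading `e`. [folklore] -/ @[simp] theorem get_e : F.get .e = F.e := rfl
/-- Reading `e2`. [folklore] -/ @[simp] theorem get_e2 : F.get .e2 = F.e2 := rfl
/-- Reading `e3`. [folklore] -/ @[simp] theorem get_e3 : F.get .e3 = F.e3 := rfl
/-- Reading `sg`. [folklore] -/ @[simp] theorem get_sg : F.get .sg = F.sg := rfl
/-- Reading `sU`. [folklore] -/ @[simp] theorem get_sU : F.get .sU = F.sU := rfl
/-- Reading `cU`. [folklore] -/ @[simp] theorem get_cU : F.get .cU = F.cU := rfl
/-- Reading `q`. [folklore] -/ @[simp] theorem get_q : F.get .q = F.q := rfl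
/-- Reading `d`. [folklore] -/ @[simp] theorem get_d : F.get .d = F.d := rfl
/-- Reading `rD`. [folklore] -/ @[simp] theorem get_rD : F.get .rD = F.rD := rfl
/-- Reading `rRow`. [folklore] -/ @[simp] theorem get_rRow : F.get .rRow = F.rRow := rfl
/-- Reading `d2`. [folklore] -/ @[simp] theorem get_d2 : F.get .d2 = F.d2 := rfl
/-- Reading `rO`. [folklore] -/ @[simp] theorem get_rO : F.get .rO = F.rO := rfl
/-- Reading `fl`. [folklore] -/ @[simp] theorem get_fl : F.get .fl = F.fl := rfl
/-- Reading `t1`. [folklore] -/ @[simp] theorem get_t1 : F.get .t1 = F.t1 := rfl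
/-- Reading `t2`. [folklore] -/ @[simp] theorem get_t2 : F.get .t2 = F.t2 := rfl
/-- Writing `x`. [folklore] -/
@[simp] theorem update_x : Function.update F.get .x v = { F with x := v }.get := by
  funext r; cases r <;> rfl
/-- Writing `tr`. [folklore] -/
@[simp] theorem update_tr : Function.update F.get .tr v = { F with tr := v }.get := by
  funext r; cases r <;> rfl
/-- Writing `out`. [folklore] -/
@[simp] theorem update_out : Function.update F.get .out v = { F with out := v }.get := by
  funext r; cases r <;> rfl
/-- Writing `A`. [folklore] -/
@[simp] theorem update_A : Function.update F.get .A v = { F with A := v }.get := by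
  funext r; cases r <;> rfl
/-- Writing `Tt`. [folklore] -/
@[simp] theorem update_Tt : Function.update F.get .Tt v = { F with Tt := v }.get := by
  funext r; cases r <;> rfl
/-- Writing `M`. [folklore] -/
@[simp] theorem update_M : Function.update F.get .M v = { F with M := v }.get := by
  funext r; cases r <;> rfl
/-- Writing `P`. [folklore] -/
@[simp] theorem update_P : Function.update F.get .P v = { F with P := v }.get := by
  funext r; cases r <;> rfl
/-- Writing `K`. [folklore] -/
@[simp] theorem update_K : Function.update F.get .K v = { F with K := v }.get := by
  funext r; cases r <;> rfl
/-- Writing `li`. [folklore] -/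
@[simp] theorem update_li : Function.update F.get .li v = { F with li := v }.get := by
  funext r; cases r <;> rfl
/-- Writing `er`. [folklore] -/
@[simp] theorem update_er : Function.update F.get .er v = { F with er := v }.get := by
  funext r; cases r <;> rfl
/-- Writing `nk`. [folklore] -/
@[simp] theorem update_nk : Function.update F.get .nk v = { F with nk := v }.get := by
  funext r; cases r <;> rfl
/-- Writing `nc`. [folklore] -/
@[simp] theorem update_nc : Function.update F.get .nc v = { F with nc := v }.get := by
  funext r; cases r <;> rfl
/-- Writing `mc`. [folklore] -/
@[simp] theorem update_mc : Function.update F.get .mc v = { F with mc := v }.get := by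
  funext r; cases r <;> rfl
/-- Writing `hm`. [folklore] -/
@[simp] theorem update_hm : Function.update F.get .hm v = { F with hm := v }.get := by
  funext r; cases r <;> rfl
/-- Writing `ents`. [folklore] -/
@[simp] theorem update_ents : Function.update F.get .ents v = { F with ents := v }.get := by
  funext r; cases r <;> rfl
/-- Writing `nU`. [folklore] -/
@[simp] theorem update_nU : Function.update F.get .nU v = { F with nU := v }.get := by
  funext r; cases r <;> rfl
/-- Writing `nV`. [folklore] -/
@[simp] theorem update_nV : Function.update F.get .nV v = { F with nV := v }.get := by
  funext r; cases r <;> rfl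
/-- Writing `jU`. [folklore] -/
@[simp] theorem update_jU : Function.update F.get .jU v = { F with jU := v }.get := by
  funext r; cases r <;> rfl
/-- Writing `e`. [folklore] -/
@[simp] theorem update_e : Function.update F.get .e v = { F with e := v }.get := by
  funext r; cases r <;> rfl
/-- Writing `e2`. [folklore] -/
@[simp] theorem update_e2 : Function.update F.get .e2 v = { F with e2 := v }.get := by
  funext r; cases r <;> rfl
/-- Writing `e3`. [folklore] -/
@[simp] theorem update_e3 : Function.update F.get .e3 v = { F with e3 := v }.get := by
  funext r; cases r <;> rfl
/-- Writing `sg`. [folklore] -/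
@[simp] theorem update_sg : Function.update F.get .sg v = { F with sg := v }.get := by
  funext r; cases r <;> rfl
/-- Writing `sU`. [folklore] -/
@[simp] theorem update_sU : Function.update F.get .sU v = { F with sU := v }.get := by
  funext r; cases r <;> rfl
/-- Writing `cU`. [folklore] -/
@[simp] theorem update_cU : Function.update F.get .cU v = { F with cU := v }.get := by
  funext r; cases r <;> rfl
/-- Writing `q`. [folklore] -/
@[simp] theorem update_q : Function.update F.get .q v = { F with q := v }.get := by
  funext r; cases r <;> rfl
/-- Writing `d`. [folklore] -/
@[simp] theorem update_d : Function.update F.get .d v = { F with d := v }.get := by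
  funext r; cases r <;> rfl
/-- Writing `rD`. [folklore] -/
@[simp] theorem update_rD : Function.update F.get .rD v = { F with rD := v }.get := by
  funext r; cases r <;> rfl
/-- Writing `rRow`. [folklore] -/
@[simp] theorem update_rRow : Function.update F.get .rRow v = { F with rRow := v }.get := by
  funext r; cases r <;> rfl
/-- Writing `d2`. [folklore] -/
@[simp] theorem update_d2 : Function.update F.get .d2 v = { F with d2 := v }.get := by
  funext r; cases r <;> rfl
/-- Writing `rO`. [folklore] -/
@[simp] theorem update_rO : Function.update F.get .rO v = { F with rO := v }.get := by
  funext r; cases r <;> rfl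
/-- Writing `fl`. [folklore] -/
@[simp] theorem update_fl : Function.update F.get .fl v = { F with fl := v }.get := by
  funext r; cases r <;> rfl
/-- Writing `t1`. [folklore] -/
@[simp] theorem update_t1 : Function.update F.get .t1 v = { F with t1 := v }.get := by
  funext r; cases r <;> rfl
/-- Writing `t2`. [folklore] -/
@[simp] theorem update_t2 : Function.update F.get .t2 v = { F with t2 := v }.get := by
  funext r; cases r <;> rfl

end Lemmas

end GF

/-! ### From the brick's initial register file to the record -/

/-- The two-operand initial register file as a record. [folklore] -/
theorem init2_eq (a b : List Bool) : Brick.init2 G.x G.tr a b = ({ x := a, tr := b } : GF).get := by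
  funext r; cases r <;> rfl

/-- `take` of a unary string. [folklore] -/
theorem take_ones (k m : ℕ) : (ones m).take k = ones (min k m) := by
  simp [ones, List.take_replicate]

/-! ### Phase P0: the cap `K = 1^{|x|}` -/

/-- Count the input into `K` (through `t1`) and restore it. [folklore] -/
def countK : Com G := cntLoop G.x G.t1 G.K ;; pour G.t1 G.x

/-- **Effect of `countK`**: `K := 1^{|x|}`, everything else unchanged. [folklore] -/
theorem runs_countK (F : GF) :
    Runs countK { F with t1 := [], K := [] }.get { F with t1 := [], K := ones F.x.length }.get (7 * F.x.length + 2) := by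
  have h1 := runs_cntLoop (k := G.x) (t := G.t1) (K := G.K) (by decide) (by decide) (by decide) F.x
    ({ F with t1 := [], K := [] } : GF).get rfl
  simp only [GF.get_t1, GF.get_K, GF.update_x, GF.update_t1, GF.update_K, List.append_nil] at h1
  have h2 := runs_pour (a := G.t1) (b := G.x) (by decide) ({ F with x := [], t1 := F.x.reverse, K := ones F.x.length } : GF).get
  simp only [GF.get_t1, GF.get_x, GF.update_t1, GF.update_x, List.reverse_reverse, List.append_nil,
    List.length_reverse] at h2
  exact (h1.seq h2).of_eq rfl (by omega)

/-! ### Phase P1: split the input `x = ⟨li, er⟩` -/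

/-- Decode the input pair: `li := (boolUnpair x).1`, `er := (boolUnpair x).2` (both in order),
emptying `x`. [folklore] -/
def splitX : Com G := unpairW G.x G.A G.Tt G.M G.P ;; pour G.A G.li ;; pour G.Tt G.er ;; clear G.M

/-- **Effect of `splitX`** (cost `≤ 13|x| + 12`). [folklore] -/
theorem runs_splitX (F : GF) :
    Runs splitX { F with A := [], Tt := [], M := [], P := [], li := [], er := [] }.get
      { F with x := [], A := [], Tt := [], M := [], P := [], li := (boolUnpair F.x).1, er := (boolUnpair F.x).2 }.get
      (13 * F.x.length + 12) := by
  have hlen := length_boolUnpair_parts_le F.x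
  have h1 := runs_unpairW (k := G.x) (a := G.A) (t := G.Tt) (M := G.M) (P := G.P) (by decide)
    ({ F with A := [], Tt := [], M := [], P := [], li := [], er := [] } : GF).get rfl rfl
  simp only [GF.get_x, GF.get_A, GF.get_Tt, GF.update_x, GF.update_A, GF.update_Tt, GF.update_M, GF.update_P,
    List.append_nil] at h1
  have h2 := runs_pour (a := G.A) (b := G.li) (by decide)
    ({ F with x := [], A := (boolUnpair F.x).1.reverse, Tt := (boolUnpair F.x).2.reverse, M := flag (wellPaired F.x), P := [], li := [], er := [] } : GF).get
  simp only [GF.get_A, GF.get_li, GF.update_A, GF.update_li, List.reverse_reverse, List.append_nil,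
    List.length_reverse] at h2
  have h3 := runs_pour (a := G.Tt) (b := G.er) (by decide)
    ({ F with x := [], A := [], Tt := (boolUnpair F.x).2.reverse, M := flag (wellPaired F.x), P := [], li := (boolUnpair F.x).1, er := [] } : GF).get
  simp only [GF.get_Tt, GF.get_er, GF.update_Tt, GF.update_er, List.reverse_reverse, List.append_nil,
    List.length_reverse] at h3
  have h4 := runs_clear G.M
    ({ F with x := [], A := [], Tt := [], M := flag (wellPaired F.x), P := [], li := (boolUnpair F.x).1, er := (boolUnpair F.x).2 } : GF).get
  simp only [GF.get_M, GF.update_M] at h4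
  have hfl := length_flag_le (wellPaired F.x)
  exact (h1.seq (h2.seq (h3.seq h4))).of_eq rfl (by omega)

/-! ### Phase P2: split `li = ⟨nc, mc⟩` -/

/-- Decode `li`: `A := reverse nc`, a copy `nk := reverse nc`, `mc := (boolUnpair li).2` (in order),
emptying `li`. [folklore] -/
def splitLi : Com G := unpairW G.li G.A G.Tt G.M G.P ;; pour G.Tt G.mc ;; clear G.M ;; copy G.A G.nk G.t1 G.t2

/-- **Effect of `splitLi`** (cost `≤ 20|li| + 14`). [folklore] -/
theorem runs_splitLi (F : GF) :
    Runs splitLi { F with A := [], Tt := [], M := [], P := [], mc := [], nk := [], t1 := [], t2 := [] }.get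
      { F with li := [], A := (boolUnpair F.li).1.reverse, Tt := [], M := [], P := [], mc := (boolUnpair F.li).2, nk := (boolUnpair F.li).1.reverse, t1 := [], t2 := [] }.get
      (20 * F.li.length + 14) := by
  have hlen := length_boolUnpair_parts_le F.li
  have h1 := runs_unpairW (k := G.li) (a := G.A) (t := G.Tt) (M := G.M) (P := G.P) (by decide)
    ({ F with A := [], Tt := [], M := [], P := [], mc := [], nk := [], t1 := [], t2 := [] } : GF).get rfl rfl
  simp only [GF.get_li, GF.get_A, GF.get_Tt, GF.update_li, GF.update_A, GF.update_Tt, GF.update_M, GF.update_P,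
    List.append_nil] at h1
  have h2 := runs_pour (a := G.Tt) (b := G.mc) (by decide)
    ({ F with li := [], A := (boolUnpair F.li).1.reverse, Tt := (boolUnpair F.li).2.reverse, M := flag (wellPaired F.li), P := [], mc := [], nk := [], t1 := [], t2 := [] } : GF).get
  simp only [GF.get_Tt, GF.get_mc, GF.update_Tt, GF.update_mc, List.reverse_reverse, List.append_nil,
    List.length_reverse] at h2
  have h3 := runs_clear G.M
    ({ F with li := [], A := (boolUnpair F.li).1.reverse, Tt := [], M := flag (wellPaired F.li), P := [], mc := (boolUnpair F.li).2, nk := [], t1 := [], t2 := [] } : GF).get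
  simp only [GF.get_M, GF.update_M] at h3
  have hfl := length_flag_le (wellPaired F.li)
  have h4 := runs_copy (a := G.A) (b := G.nk) (t := G.t1) (u := G.t2) (by decide) (by decide) (by decide)
    (by decide) (by decide) (by decide)
    ({ F with li := [], A := (boolUnpair F.li).1.reverse, Tt := [], M := [], P := [], mc := (boolUnpair F.li).2, nk := [], t1 := [], t2 := [] } : GF).get rfl rfl
  simp only [GF.get_A, GF.get_nk, GF.update_nk, List.append_nil, List.length_reverse] at h4
  exact (h1.seq (h2.seq (h3.seq h4))).of_eq rfl (by omega)

/-! ### Phase P3: the dimension in unary, saturating at the cap -/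

/-- One step of the saturating evaluation on the bit `b`: `nU := 1^{min (2|nU| + b) |K|}`
(double, add the bit, clamp to `|K|` by `takeN` through `q`, `d`). [folklore] -/
def satBody (b : Bool) : Com G :=
  dblReg G.nU G.t1 ;; (bif b then push G.nU true else skip) ;; copy G.K G.q G.t1 G.t2 ;;
    takeN G.q G.nU G.d ;; clear G.nU ;; pour G.d G.nU

/-- The saturating evaluation loop over `A` (most significant bit on top). [folklore] -/
def satLoop : Com G := loop G.A (satBody true) (satBody false)

/-- **Effect of `satBody b`** (cost `≤ 40 (m + |K|) + 20` for `nU = 1ᵐ`). [folklore] -/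
theorem runs_satBody (F : GF) (m : ℕ) (b : Bool) :
    Runs (satBody b) { F with nU := ones m, q := [], d := [], t1 := [], t2 := [] }.get
      { F with nU := ones (min (b.toNat + 2 * m) F.K.length), q := [], d := [], t1 := [], t2 := [] }.get
      (40 * (m + F.K.length) + 20) := by
  have h1 := runs_dblReg (p := G.nU) (t := G.t1) (by decide) ({ F with nU := ones m, q := [], d := [], t1 := [], t2 := [] } : GF).get rfl
  simp only [GF.get_nU, GF.update_nU, length_ones] at h1
  have h2 : Runs (bif b then push G.nU true else skip) ({ F with nU := ones (2 * m), q := [], d := [], t1 := [], t2 := [] } : GF).get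
      ({ F with nU := ones (b.toNat + 2 * m), q := [], d := [], t1 := [], t2 := [] } : GF).get 1 := by
    cases b
    · rw [show false.toNat + 2 * m = 2 * m by simp]
      exact (Runs.skip ({ F with nU := ones (2 * m), q := [], d := [], t1 := [], t2 := [] } : GF).get).mono (by omega)
    · refine (Runs.push G.nU true _).of_eq ?_ le_rfl
      simp only [GF.get_nU, GF.update_nU, Bool.toNat_true]
      rw [show 1 + 2 * m = 2 * m + 1 by ring, ones_succ]
  set m' := b.toNat + 2 * m with hm'
  have h3 := runs_copy (a := G.K) (b := G.q) (t := G.t1) (u := G.t2) (by decide) (by decide) (by decide)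
    (by decide) (by decide) (by decide) ({ F with nU := ones m', q := [], d := [], t1 := [], t2 := [] } : GF).get rfl rfl
  simp only [GF.get_K, GF.get_q, GF.update_q, List.append_nil] at h3
  have h4 := runs_takeN (q := G.q) (s := G.nU) (d := G.d) (by decide) (by decide) (by decide) F.K
    ({ F with nU := ones m', q := F.K, d := [], t1 := [], t2 := [] } : GF).get rfl
  simp only [GF.get_nU, GF.get_d, GF.update_q, GF.update_nU, GF.update_d, List.append_nil, take_ones,
    List.reverse_replicate, ones] at h4
  have h5 := runs_clear G.nU
    ({ F with nU := (List.replicate m' true).drop F.K.length, q := [], d := List.replicate (min F.K.length m') true, t1 := [], t2 := [] } : GF).get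
  simp only [GF.get_nU, GF.update_nU, List.length_drop, List.length_replicate] at h5
  have h6 := runs_pour (a := G.d) (b := G.nU) (by decide)
    ({ F with nU := [], q := [], d := List.replicate (min F.K.length m') true, t1 := [], t2 := [] } : GF).get
  simp only [GF.get_d, GF.get_nU, GF.update_d, GF.update_nU, List.reverse_replicate, List.append_nil,
    List.length_replicate] at h6
  have hmin : min F.K.length m' ≤ F.K.length := min_le_left _ _
  have hm'le : m' ≤ 2 * m + 1 := by have := Bool.toNat_le b; omega
  refine (h1.seq (h2.seq (h3.seq (h4.seq (h5.seq h6))))).of_eq ?_ (by omega)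
  rw [min_comm]

/-- The saturating evaluation processed by the loop: bits `w` (in pop order) folded into `m`.
[folklore] -/
def satGo (K : ℕ) : List Bool → ℕ → ℕ
  | [], m => m
  | c :: w, m => satGo K w (min (c.toNat + 2 * m) K)

/-- `satGo` over a concatenation. [folklore] -/
theorem satGo_append (K : ℕ) : ∀ (u v : List Bool) (m : ℕ), satGo K (u ++ v) m = satGo K v (satGo K u m)
  | [], _, _ => rfl
  | _ :: u, v, _ => satGo_append K u v _

/-- Folding the reversed bit string from `0` is the saturating value. [folklore] -/
theorem satGo_reverse (K : ℕ) : ∀ l : List Bool, satGo K l.reverse 0 = satVal K l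
  | [] => rfl
  | b :: l => by
    rw [List.reverse_cons, satGo_append, satGo_reverse K l, satGo, satGo, satVal]

/-- **Effect of `satLoop`** (cost `≤ (80|K| + 62)|A| + 1` from `nU = 1ᵐ`, `m ≤ |K|`). [folklore] -/
theorem runs_satLoop : ∀ (w : List Bool) (F : GF) (m : ℕ), m ≤ F.K.length →
    Runs satLoop { F with A := w, nU := ones m, q := [], d := [], t1 := [], t2 := [] }.get
      { F with A := [], nU := ones (satGo F.K.length w m), q := [], d := [], t1 := [], t2 := [] }.get
      ((80 * F.K.length + 62) * w.length + 1)
  | [], F, m, hm => by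
    refine (Runs.loop_nil _ _ rfl).of_eq ?_ (by simp)
    rw [satGo]
  | c :: w, F, m, hm => by
    have hbody := runs_satBody { F with A := w } m c
    dsimp only at hbody
    have ih := runs_satLoop w F (min (c.toNat + 2 * m) F.K.length) (min_le_right _ _)
    have hk : ({ F with A := c :: w, nU := ones m, q := [], d := [], t1 := [], t2 := [] } : GF).get G.A = c :: w := rfl
    have hupd : Function.update ({ F with A := c :: w, nU := ones m, q := [], d := [], t1 := [], t2 := [] } : GF).get G.A w =
        ({ F with A := w, nU := ones m, q := [], d := [], t1 := [], t2 := [] } : GF).get := by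
      simp
    rw [show (80 * F.K.length + 62) * (c :: w).length + 1 =
      (40 * (m + F.K.length) + 20) + (40 * (F.K.length - m) + 40) + 2 + ((80 * F.K.length + 62) * w.length + 1) by
      rw [List.length_cons, Nat.mul_succ]; omega]
    cases c
    · exact Runs.loop_false' hk hupd (hbody.mono (by omega)) (ih.of_eq rfl le_rfl)
    · exact Runs.loop_true' hk hupd (hbody.mono (by omega)) (ih.of_eq rfl le_rfl)

/-! ### Phase Q1: split the transcript code `T = ⟨U, body⟩` -/

/-- Decode the transcript code: `A := reverse U` (so `|A| = tlen T`), `tr := body` (in order).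
[folklore] -/
def splitT : Com G := unpairW G.tr G.A G.Tt G.M G.P ;; pour G.Tt G.tr ;; clear G.M

/-- **Effect of `splitT`** (cost `≤ 10|tr| + 11`). [folklore] -/
theorem runs_splitT (F : GF) :
    Runs splitT { F with A := [], Tt := [], M := [], P := [] }.get
      { F with tr := (boolUnpair F.tr).2, A := (boolUnpair F.tr).1.reverse, Tt := [], M := [], P := [] }.get
      (10 * F.tr.length + 11) := by
  have hlen := length_boolUnpair_parts_le F.tr
  have h1 := runs_unpairW (k := G.tr) (a := G.A) (t := G.Tt) (M := G.M) (P := G.P) (by decide)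
    ({ F with A := [], Tt := [], M := [], P := [] } : GF).get rfl rfl
  simp only [GF.get_tr, GF.get_A, GF.get_Tt, GF.update_tr, GF.update_A, GF.update_Tt, GF.update_M, GF.update_P,
    List.append_nil] at h1
  have h2 := runs_pour (a := G.Tt) (b := G.tr) (by decide)
    ({ F with tr := [], A := (boolUnpair F.tr).1.reverse, Tt := (boolUnpair F.tr).2.reverse, M := flag (wellPaired F.tr), P := [] } : GF).get
  simp only [GF.get_Tt, GF.get_tr, GF.update_Tt, GF.update_tr, List.reverse_reverse, List.append_nil,
    List.length_reverse] at h2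
  have h3 := runs_clear G.M
    ({ F with tr := (boolUnpair F.tr).2, A := (boolUnpair F.tr).1.reverse, Tt := [], M := flag (wellPaired F.tr), P := [] } : GF).get
  simp only [GF.get_M, GF.update_M] at h3
  have hfl := length_flag_le (wellPaired F.tr)
  exact (h1.seq (h2.seq h3)).of_eq rfl (by omega)

/-! ### The parsing prelude -/

/-- The parsing prelude shared by the bricks: cap, input split, header split, saturating
evaluation (`nU := 1^{dimOf x}`). [folklore] -/
def prelude : Com G := countK ;; splitX ;; splitLi ;; satLoop

/-- The dimension read off a string is at most its length. [folklore] -/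
theorem dimOf_le (x : List Bool) : dimOf x ≤ x.length := by
  rw [dimOf, satVal_eq_min]; exact min_le_right _ _

/-- The record after the prelude on operands `a`, `b`. [folklore] -/
def preF (a b : List Bool) : GF :=
  { tr := b, K := ones a.length, er := (boolUnpair a).2, nk := (boolUnpair (boolUnpair a).1).1.reverse,
    mc := (boolUnpair (boolUnpair a).1).2, nU := ones (dimOf a) }

/-- **Effect of the prelude** from the initial record. [folklore] -/
theorem runs_prelude (a b : List Bool) :
    Runs prelude ({ x := a, tr := b } : GF).get (preF a b).get (200 * (a.length + 1) ^ 2) := by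
  have hl1 := length_boolUnpair_parts_le a
  have hl2 := length_boolUnpair_parts_le (boolUnpair a).1
  have h1 := runs_countK ({ x := a, tr := b } : GF)
  dsimp only at h1
  have h2 := runs_splitX ({ x := a, tr := b, K := ones a.length } : GF)
  dsimp only at h2
  have h3 := runs_splitLi ({ x := [], tr := b, K := ones a.length, li := (boolUnpair a).1, er := (boolUnpair a).2 } : GF)
  dsimp only at h3
  have h4 := runs_satLoop (boolUnpair (boolUnpair a).1).1.reverse
    ({ x := [], tr := b, K := ones a.length, li := [], er := (boolUnpair a).2, nk := (boolUnpair (boolUnpair a).1).1.reverse, mc := (boolUnpair (boolUnpair a).1).2 } : GF)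
    0 (Nat.zero_le _)
  dsimp only at h4
  simp only [length_ones, List.length_reverse, satGo_reverse] at h4
  have hdim : satVal a.length (boolUnpair (boolUnpair a).1).1 = dimOf a := rfl
  rw [hdim] at h4
  refine (h1.seq (h2.seq (h3.seq h4))).of_eq rfl ?_
  have hx : (boolUnpair a).1.length ≤ a.length := by omega
  have hn : (boolUnpair (boolUnpair a).1).1.length ≤ a.length := by omega
  have h5 : 20 * (boolUnpair a).1.length ≤ 20 * a.length := by omega
  have h6 : (80 * a.length + 62) * (boolUnpair (boolUnpair a).1).1.length ≤ (80 * a.length + 62) * a.length :=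
    Nat.mul_le_mul_left _ hn
  have h7 : (80 * a.length + 62) * a.length + 102 * a.length + 29 ≤ 200 * (a.length + 1) ^ 2 := by nlinarith
  omega

/-! ### Brick 1: is the dimension `0`? -/

/-- Brick 1: prelude, then the one-bit answer `[nU = []]`. [folklore] -/
def brick1 : Com G := prelude ;; pop G.nU (push G.out false) (push G.out false) (push G.out true)

/-- **Effect of brick 1**: `out = [decide (dimOf x = 0)]`. [folklore] -/
theorem runs_brick1 (a b : List Bool) :
    ∃ R', Runs brick1 (Brick.init2 G.x G.tr a b) R' (200 * (a.length + 1) ^ 2 + 3) ∧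
      R' G.out = [decide (dimOf a = 0)] := by
  rw [init2_eq]
  have h1 := runs_prelude a b
  cases hn : dimOf a with
  | zero =>
    refine ⟨{ preF a b with out := [true] }.get, h1.seq ?_, by simp⟩
    refine (Runs.pop_nil _ _ (k := G.nU) ?_ (Runs.push G.out true _)).of_eq ?_ (by norm_num)
    · simp [preF, hn, ones]
    · simp [preF]
  | succ n =>
    refine ⟨{ preF a b with nU := ones n, out := [false] }.get, h1.seq ?_, by simp⟩
    refine (Runs.pop_true _ _ (k := G.nU) (w := ones n) ?_ (Runs.push G.out false _)).of_eq ?_ (by norm_num)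
    · simp [preF, hn, ones_succ]
    · simp [preF]

/-! ### Brick 2: does the transcript record the answer `[true]`? -/

/-- Iterated second component of the pair decoder (walking a framed list). [folklore] -/
def unp2It : ℕ → List Bool → List Bool
  | 0, t => t
  | k + 1, t => unp2It k (boolUnpair t).2

/-- The walk shrinks the string. [folklore] -/
theorem length_unp2It_le : ∀ (k : ℕ) (t : List Bool), (unp2It k t).length ≤ t.length
  | 0, _ => le_rfl
  | k + 1, t => (length_unp2It_le k _).trans (by have := length_boolUnpair_parts_le t; omega)

/-- Raise the flag `fl`. [folklore] -/
def setF : Com G := pop G.fl (push G.fl true) (push G.fl true) (push G.fl true)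

/-- Test whether `e = [true]` (raising the flag if so), emptying `e`. [folklore] -/
def testE : Com G := pop G.e (pop G.e (clear G.e) (clear G.e) setF) (clear G.e) skip

/-- **Effect of `setF`**: the flag becomes `[true]`. [folklore] -/
theorem runs_setF (F : GF) (c : Bool) : Runs setF { F with fl := flag c }.get { F with fl := [true] }.get 3 := by
  cases c
  · refine (Runs.pop_nil _ _ (k := G.fl) rfl (Runs.push G.fl true _)).of_eq ?_ le_rfl
    simp [flag]
  · refine (Runs.pop_true _ _ (k := G.fl) (w := []) rfl (Runs.push G.fl true _)).of_eq ?_ le_rfl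
    simp [flag]

/-- **Effect of `testE`** (cost `≤ 2|e| + 8`): `fl := flag (c || [e = [true]])`, `e := []`. [folklore] -/
theorem runs_testE (F : GF) (v : List Bool) (c : Bool) :
    Runs testE { F with e := v, fl := flag c }.get { F with e := [], fl := flag (c || decide (v = [true])) }.get
      (2 * v.length + 8) := by
  rcases v with _ | ⟨b, v⟩
  · refine (Runs.pop_nil _ _ (k := G.e) rfl (Runs.skip _)).of_eq ?_ ?_
    · simp
    · norm_num
  · have hk : ({ F with e := b :: v, fl := flag c } : GF).get G.e = b :: v := rfl
    have hupd : Function.update ({ F with e := b :: v, fl := flag c } : GF).get G.e v =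
        ({ F with e := v, fl := flag c } : GF).get := by simp
    cases b
    · have h := runs_clear G.e ({ F with e := v, fl := flag c } : GF).get
      simp only [GF.get_e, GF.update_e] at h
      refine (Runs.pop_false' _ _ hk hupd h).of_eq ?_ ?_
      · simp
      · simp only [List.length_cons]; omega
    · rcases v with _ | ⟨d, v⟩
      · have h := runs_setF { F with e := [] } c
        dsimp only at h
        have hk2 : ({ F with e := ([] : List Bool), fl := flag c } : GF).get G.e = [] := rfl
        refine (Runs.pop_true' _ _ hk hupd (Runs.pop_nil _ _ hk2 h)).of_eq ?_ ?_
        · simp [flag]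
        · norm_num
      · have hk2 : ({ F with e := d :: v, fl := flag c } : GF).get G.e = d :: v := rfl
        have hupd2 : Function.update ({ F with e := d :: v, fl := flag c } : GF).get G.e v =
            ({ F with e := v, fl := flag c } : GF).get := by simp
        have h := runs_clear G.e ({ F with e := v, fl := flag c } : GF).get
        simp only [GF.get_e, GF.update_e] at h
        have hne : decide (true :: d :: v = [true]) = false := by simp
        rw [hne, Bool.or_false]
        cases d
        · refine (Runs.pop_true' _ _ hk hupd (Runs.pop_false' _ _ hk2 hupd2 h)).of_eq ?_ ?_
          · simp
          · simp; omega
        · refine (Runs.pop_true' _ _ hk hupd (Runs.pop_true' _ _ hk2 hupd2 h)).of_eq ?_ ?_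
          · simp
          · simp; omega

/-- One item of the scan: split off the next framed item of `tr` into `e` (reversed), restore
the rest of `tr`, and test the item. [folklore] -/
def hasBody : Com G := unpairW G.tr G.e G.Tt G.M G.P ;; pour G.Tt G.tr ;; clear G.M ;; testE

/-- The scan over the `|A|` first items of `tr`. [folklore] -/
def hasLoop : Com G := loop G.A hasBody hasBody

/-- `reverse v = [true] ↔ v = [true]`. [folklore] -/
theorem decide_reverse_eq_single (v : List Bool) : decide (v.reverse = [true]) = decide (v = [true]) := by
  by_cases h : v = [true]
  · subst h; simp
  · have : v.reverse ≠ [true] := fun h' => h (by simpa using congrArg List.reverse h')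
    simp [h, this]

/-- **Effect of `hasBody`** (cost `≤ 12|tr| + 19`). [folklore] -/
theorem runs_hasBody (F : GF) (c : Bool) :
    Runs hasBody { F with e := [], Tt := [], M := [], P := [], fl := flag c }.get
      { F with tr := (boolUnpair F.tr).2, e := [], Tt := [], M := [], P := [], fl := flag (c || decide ((boolUnpair F.tr).1 = [true])) }.get
      (12 * F.tr.length + 19) := by
  have hlen := length_boolUnpair_parts_le F.tr
  have h1 := runs_unpairW (k := G.tr) (a := G.e) (t := G.Tt) (M := G.M) (P := G.P) (by decide)
    ({ F with e := [], Tt := [], M := [], P := [], fl := flag c } : GF).get rfl rfl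
  simp only [GF.get_tr, GF.get_e, GF.get_Tt, GF.update_tr, GF.update_e, GF.update_Tt, GF.update_M, GF.update_P,
    List.append_nil] at h1
  have h2 := runs_pour (a := G.Tt) (b := G.tr) (by decide)
    ({ F with tr := [], e := (boolUnpair F.tr).1.reverse, Tt := (boolUnpair F.tr).2.reverse, M := flag (wellPaired F.tr), P := [], fl := flag c } : GF).get
  simp only [GF.get_Tt, GF.get_tr, GF.update_Tt, GF.update_tr, List.reverse_reverse, List.append_nil,
    List.length_reverse] at h2
  have h3 := runs_clear G.M
    ({ F with tr := (boolUnpair F.tr).2, e := (boolUnpair F.tr).1.reverse, Tt := [], M := flag (wellPaired F.tr), P := [], fl := flag c } : GF).get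
  simp only [GF.get_M, GF.update_M] at h3
  have hfl := length_flag_le (wellPaired F.tr)
  have h4 := runs_testE { F with tr := (boolUnpair F.tr).2, Tt := [], M := [], P := [] } (boolUnpair F.tr).1.reverse c
  simp only [List.length_reverse, decide_reverse_eq_single] at h4
  exact (h1.seq (h2.seq (h3.seq h4))).of_eq rfl (by omega)

/-- The flag computed by the scan. [folklore] -/
def hasGo : ℕ → List Bool → Bool → Bool
  | 0, _, c => c
  | k + 1, t, c => hasGo k (boolUnpair t).2 (c || decide ((boolUnpair t).1 = [true]))

/-- The scan computes the disjunction with `hasTrue`. [folklore] -/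
theorem hasGo_eq : ∀ (k : ℕ) (t : List Bool) (c : Bool), hasGo k t c = (c || hasTrue k t)
  | 0, t, c => by simp [hasGo, hasTrue]
  | k + 1, t, c => by rw [hasGo, hasGo_eq k, hasTrue, Bool.or_assoc]

/-- The walk of the scan. [folklore] -/
theorem unp2It_succ' : ∀ (k : ℕ) (t : List Bool), unp2It (k + 1) t = (boolUnpair (unp2It k t)).2
  | 0, _ => rfl
  | k + 1, _ => unp2It_succ' k _

/-- **Effect of `hasLoop`** (cost `≤ (12 T + 21)|A| + 1` when `|tr| ≤ T`). [folklore] -/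
theorem runs_hasLoop (T : ℕ) : ∀ (w : List Bool) (F : GF) (c : Bool), F.tr.length ≤ T →
    Runs hasLoop { F with A := w, e := [], Tt := [], M := [], P := [], fl := flag c }.get
      { F with A := [], tr := unp2It w.length F.tr, e := [], Tt := [], M := [], P := [], fl := flag (hasGo w.length F.tr c) }.get
      ((12 * T + 21) * w.length + 1)
  | [], F, c, hT => by
    refine (Runs.loop_nil _ _ rfl).of_eq ?_ (by simp)
    simp [unp2It, hasGo]
  | d :: w, F, c, hT => by
    have hbody := runs_hasBody { F with A := w } c
    dsimp only at hbody
    have ih := runs_hasLoop T w { F with tr := (boolUnpair F.tr).2 } (c || decide ((boolUnpair F.tr).1 = [true]))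
      ((show ((boolUnpair F.tr).2).length ≤ F.tr.length by have := length_boolUnpair_parts_le F.tr; omega).trans hT)
    dsimp only at ih
    have hk : ({ F with A := d :: w, e := [], Tt := [], M := [], P := [], fl := flag c } : GF).get G.A = d :: w := rfl
    have hupd : Function.update ({ F with A := d :: w, e := [], Tt := [], M := [], P := [], fl := flag c } : GF).get G.A w =
        ({ F with A := w, e := [], Tt := [], M := [], P := [], fl := flag c } : GF).get := by
      simp
    have hcost : 12 * F.tr.length + 19 ≤ 12 * T + 19 := by omega
    rw [show (12 * T + 21) * (d :: w).length + 1 = (12 * T + 19) + 2 + ((12 * T + 21) * w.length + 1) by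
      rw [List.length_cons, Nat.mul_succ]; omega]
    have hfin : ({ F with A := [], tr := unp2It w.length (boolUnpair F.tr).2, e := [], Tt := [], M := [], P := [], fl := flag (hasGo w.length (boolUnpair F.tr).2 (c || decide ((boolUnpair F.tr).1 = [true]))) } : GF).get =
        ({ F with A := [], tr := unp2It (d :: w).length F.tr, e := [], Tt := [], M := [], P := [], fl := flag (hasGo (d :: w).length F.tr c) } : GF).get := by
      rfl
    cases d
    · exact Runs.loop_false' hk hupd (hbody.mono hcost) (ih.of_eq hfin le_rfl)
    · exact Runs.loop_true' hk hupd (hbody.mono hcost) (ih.of_eq hfin le_rfl)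

/-- Brick 2: split the transcript code, scan its items, output the flag as one bit. [folklore] -/
def brick2 : Com G := splitT ;; hasLoop ;; pop G.fl (push G.out true) (push G.out false) (push G.out false)

/-- **Effect of brick 2**: `out = [thas T]`. [folklore] -/
theorem runs_brick2 (a b : List Bool) :
    ∃ R', Runs brick2 (Brick.init2 G.x G.tr a b) R' (30 * (b.length + 1) ^ 2 + 3) ∧ R' G.out = [thas b] := by
  rw [init2_eq]
  have hl := length_boolUnpair_parts_le b
  have h1 := runs_splitT ({ x := a, tr := b } : GF)
  dsimp only at h1
  have h2 := runs_hasLoop b.length (boolUnpair b).1.reverse ({ x := a, tr := (boolUnpair b).2 } : GF) false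
    (show ((boolUnpair b).2).length ≤ b.length by have := length_boolUnpair_parts_le b; omega)
  dsimp only at h2
  simp only [List.length_reverse, hasGo_eq, Bool.false_or] at h2
  have hthas : hasTrue (boolUnpair b).1.length (boolUnpair b).2 = thas b := rfl
  rw [hthas] at h2
  have hcost : 10 * b.length + 11 + ((12 * b.length + 21) * (boolUnpair b).1.length + 1) + 3 ≤
      30 * (b.length + 1) ^ 2 + 3 := by
    have : (12 * b.length + 21) * (boolUnpair b).1.length ≤ (12 * b.length + 21) * b.length :=
      Nat.mul_le_mul_left _ (by omega)
    nlinarith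
  set S : GF := { x := a, tr := unp2It (boolUnpair b).1.length (boolUnpair b).2, fl := flag (thas b) } with hS
  cases ht : thas b
  · have h3 : Runs (pop G.fl (push G.out true) (push G.out false) (push G.out false)) S.get { S with fl := [], out := [false] }.get 3 := by
      refine (Runs.pop_nil _ _ (k := G.fl) (by simp [hS, ht, flag]) (Runs.push G.out false _)).of_eq ?_ (by norm_num)
      simp [hS, ht, flag]
    exact ⟨_, ((h1.seq (h2.seq h3)).mono hcost), by simp [hS]⟩
  · have h3 : Runs (pop G.fl (push G.out true) (push G.out false) (push G.out false)) S.get { S with fl := [], out := [true] }.get 3 := by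
      refine (Runs.pop_true _ _ (k := G.fl) (w := []) (by simp [hS, ht, flag]) (Runs.push G.out true _)).of_eq ?_ (by norm_num)
      simp [hS, ht, flag]
    exact ⟨_, ((h1.seq (h2.seq h3)).mono hcost), by simp [hS]⟩

/-! ### Brick 3: have all calls been answered (`n ≤ j`)? -/

/-- Brick 3: prelude (`nU = 1ⁿ`), transcript split (`|A| = j`), `nU := nU ⇂ j`, output `[nU = []]`.
[folklore] -/
def brick3 : Com G :=
  prelude ;; splitT ;; subFrom G.nU G.A ;; pop G.nU (push G.out false) (push G.out false) (push G.out true)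

/-- **Effect of brick 3**: `out = [decide (dimOf x ≤ tlen T)]`. [folklore] -/
theorem runs_brick3 (a b : List Bool) :
    ∃ R', Runs brick3 (Brick.init2 G.x G.tr a b) R' (200 * (a.length + 1) ^ 2 + 14 * (b.length + 1) + 3) ∧
      R' G.out = [decide (dimOf a ≤ tlen b)] := by
  rw [init2_eq]
  have hl := length_boolUnpair_parts_le b
  have h1 := runs_prelude a b
  have h2 := runs_splitT (preF a b)
  simp only [preF] at h2
  set S : GF := { tr := (boolUnpair b).2, A := (boolUnpair b).1.reverse, K := ones a.length, er := (boolUnpair a).2, nk := (boolUnpair (boolUnpair a).1).1.reverse, mc := (boolUnpair (boolUnpair a).1).2, nU := ones (dimOf a) } with hS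
  have h3 := runs_subFrom (x := G.nU) (y := G.A) (by decide) (boolUnpair b).1.reverse S.get (by simp [hS])
  simp only [hS, GF.get_nU, GF.update_A, GF.update_nU, List.length_reverse, ones, List.drop_replicate] at h3
  have htlen : (boolUnpair b).1.length = tlen b := rfl
  set S' : GF := { tr := (boolUnpair b).2, K := ones a.length, er := (boolUnpair a).2, nk := (boolUnpair (boolUnpair a).1).1.reverse, mc := (boolUnpair (boolUnpair a).1).2, nU := ones (dimOf a - (boolUnpair b).1.length) } with hS'
  have h3' : Runs (subFrom G.nU G.A) S.get S'.get (4 * (boolUnpair b).1.length + 1) := h3.of_eq (by simp [hS', ones]) le_rfl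
  have hcost : 200 * (a.length + 1) ^ 2 + (10 * b.length + 11 + (4 * (boolUnpair b).1.length + 1 + 3)) ≤
      200 * (a.length + 1) ^ 2 + 14 * (b.length + 1) + 3 := by omega
  cases hn : dimOf a - (boolUnpair b).1.length with
  | zero =>
    have hle : decide (dimOf a ≤ tlen b) = true := by rw [← htlen]; simp; omega
    rw [hle]
    have h4 : Runs (pop G.nU (push G.out false) (push G.out false) (push G.out true)) S'.get { S' with nU := [], out := [true] }.get 3 := by
      refine (Runs.pop_nil _ _ (k := G.nU) (by simp [hS', hn, ones]) (Runs.push G.out true _)).of_eq ?_ (by norm_num)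
      simp [hS', hn, ones]
    have h1234 := (h1.seq (h2.seq (h3'.seq h4))).mono hcost
    exact ⟨_, h1234, by simp [hS']⟩
  | succ n =>
    have hle : decide (dimOf a ≤ tlen b) = false := by rw [← htlen]; simp; omega
    rw [hle]
    have h4 : Runs (pop G.nU (push G.out false) (push G.out false) (push G.out true)) S'.get { S' with nU := ones n, out := [false] }.get 3 := by
      refine (Runs.pop_true _ _ (k := G.nU) (w := ones n) (by simp [hS', hn, ones_succ]) (Runs.push G.out false _)).of_eq ?_ (by norm_num)
      simp [hS', hn]
    have h1234 := (h1.seq (h2.seq (h3'.seq h4))).mono hcost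
    exact ⟨_, h1234, by simp [hS']⟩

/-! ### Brick 4: the next query

Flat forms of the emitted pieces. The first component of the pair decoder is `unp1`, the second
`unp2`; `dbl` (`StackMachines.lean`) is the bit doubling `repBits 2`. -/

/-- Flat emission of the first `k` framed items (each doubled and closed by `01`). [folklore] -/
def emitS : ℕ → List Bool → List Bool
  | 0, _ => []
  | k + 1, w => SProg.dbl (boolUnpair w).1 ++ [false, true] ++ emitS k (boolUnpair w).2

/-- Flat emission of the first `k` framed items doubled as integers (`dblInt`), each doubled and
closed by `01`. [folklore] -/
def emitC : ℕ → List Bool → List Bool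
  | 0, _ => []
  | k + 1, w => SProg.dbl (dblInt (boolUnpair w).1) ++ [false, true] ++ emitC k (boolUnpair w).2

/-- `boolPair` flattened with `dbl`. [folklore] -/
theorem boolPair_eq_dbl (x y : List Bool) : boolPair x y = SProg.dbl x ++ [false, true] ++ y := by
  rw [boolPair_eq, dbl_eq_repBits]

/-- Snoc form of `emitS`. [folklore] -/
theorem emitS_succ' : ∀ (k : ℕ) (w : List Bool),
    emitS (k + 1) w = emitS k w ++ (SProg.dbl (boolUnpair (unp2It k w)).1 ++ [false, true])
  | 0, w => by simp [emitS, unp2It]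
  | k + 1, w => by
    rw [emitS, emitS_succ' k (boolUnpair w).2, emitS]
    simp [unp2It, List.append_assoc]

/-- Snoc form of `emitC`. [folklore] -/
theorem emitC_succ' : ∀ (k : ℕ) (w : List Bool),
    emitC (k + 1) w = emitC k w ++ (SProg.dbl (dblInt (boolUnpair (unp2It k w)).1) ++ [false, true])
  | 0, w => by simp [emitC, unp2It]
  | k + 1, w => by
    rw [emitC, emitC_succ' k (boolUnpair w).2, emitC]
    simp [unp2It, List.append_assoc]

/-- `rowRun` is the flat emission. [folklore] -/
theorem rowRun_eq_emitS : ∀ (c : ℕ) (w : List Bool), rowRun c w = emitS c w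
  | 0, _ => rfl
  | c + 1, w => by rw [rowRun, emitS, rowRun_eq_emitS c, boolPair_eq_dbl]

/-- `rowEnts` is the flat emission after the walk. [folklore] -/
theorem rowEnts_eq : ∀ (s c : ℕ) (w : List Bool), rowEnts s c w = emitS c (unp2It s w)
  | 0, c, w => rowRun_eq_emitS c w
  | s + 1, c, _ => rowEnts_eq s c _

/-- `dblRun` is the flat emission followed by the unread tail. [folklore] -/
theorem dblRun_eq : ∀ (c : ℕ) (w : List Bool), dblRun c w = emitC c w ++ unp2It c w
  | 0, _ => rfl
  | c + 1, w => by
    rw [dblRun, emitC, dblRun_eq c, boolPair_eq_dbl]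
    simp [unp2It, List.append_assoc]

/-- `dblEnts` is the flat emission of the skipped items, then `dblRun`. [folklore] -/
theorem dblEnts_eq : ∀ (s c : ℕ) (w : List Bool), dblEnts s c w = emitS s w ++ emitC c (unp2It s w) ++ unp2It c (unp2It s w)
  | 0, c, w => by simp [dblEnts, emitS, unp2It, dblRun_eq]
  | s + 1, c, w => by
    rw [dblEnts, emitS, dblEnts_eq s c, boolPair_eq_dbl]
    simp [unp2It, List.append_assoc]

/-- Doubling of a doubled integer code, flat. [folklore] -/
theorem dbl_dblInt (e : List Bool) :
    SProg.dbl (dblInt e) = repBits 4 (boolUnpair e).1 ++ [false, false, true, true] ++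
      ((match (boolUnpair e).2 with | [] => [] | _ :: _ => [false, false]) ++ SProg.dbl (boolUnpair e).2) := by
  rw [dblInt, boolPair_eq_dbl, dbl_eq_repBits, dbl_eq_repBits, repBits_append, repBits_append, repBits_repBits]
  cases (boolUnpair e).2 with
  | nil => simp [dblNat, repBits]
  | cons b l => simp [dblNat, repBits_cons, List.replicate, dbl_eq_repBits]

/-- Reverse of `dbl`. [folklore] -/
theorem reverse_dbl (w : List Bool) : (SProg.dbl w).reverse = SProg.dbl w.reverse := by
  rw [dbl_eq_repBits, dbl_eq_repBits, reverse_repBits]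

/-! #### Splitting the matrix code and emitting its header -/

/-- Decode `mc = ⟨hm, ents⟩`: `hm`, `ents` in order, emptying `mc`. [folklore] -/
def splitMc : Com G := unpairW G.mc G.A G.Tt G.M G.P ;; pour G.Tt G.ents ;; pour G.A G.hm ;; clear G.M

/-- **Effect of `splitMc`** (cost `≤ 13|mc| + 12`). [folklore] -/
theorem runs_splitMc (F : GF) :
    Runs splitMc { F with A := [], Tt := [], M := [], P := [], ents := [], hm := [] }.get
      { F with mc := [], A := [], Tt := [], M := [], P := [], ents := (boolUnpair F.mc).2, hm := (boolUnpair F.mc).1 }.get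
      (13 * F.mc.length + 12) := by
  have hlen := length_boolUnpair_parts_le F.mc
  have h1 := runs_unpairW (k := G.mc) (a := G.A) (t := G.Tt) (M := G.M) (P := G.P) (by decide)
    ({ F with A := [], Tt := [], M := [], P := [], ents := [], hm := [] } : GF).get rfl rfl
  simp only [GF.get_mc, GF.get_A, GF.get_Tt, GF.update_mc, GF.update_A, GF.update_Tt, GF.update_M, GF.update_P,
    List.append_nil] at h1
  have h2 := runs_pour (a := G.Tt) (b := G.ents) (by decide)
    ({ F with mc := [], A := (boolUnpair F.mc).1.reverse, Tt := (boolUnpair F.mc).2.reverse, M := flag (wellPaired F.mc), P := [], ents := [], hm := [] } : GF).get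
  simp only [GF.get_Tt, GF.get_ents, GF.update_Tt, GF.update_ents, List.reverse_reverse, List.append_nil,
    List.length_reverse] at h2
  have h3 := runs_pour (a := G.A) (b := G.hm) (by decide)
    ({ F with mc := [], A := (boolUnpair F.mc).1.reverse, Tt := [], M := flag (wellPaired F.mc), P := [], ents := (boolUnpair F.mc).2, hm := [] } : GF).get
  simp only [GF.get_A, GF.get_hm, GF.update_A, GF.update_hm, List.reverse_reverse, List.append_nil,
    List.length_reverse] at h3
  have h4 := runs_clear G.M
    ({ F with mc := [], A := [], Tt := [], M := flag (wellPaired F.mc), P := [], ents := (boolUnpair F.mc).2, hm := (boolUnpair F.mc).1 } : GF).get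
  simp only [GF.get_M, GF.update_M] at h4
  have hfl := length_flag_le (wellPaired F.mc)
  exact (h1.seq (h2.seq (h3.seq h4))).of_eq rfl (by omega)

/-- Emit the header `hm` doubled and its separator into `rD`. [folklore] -/
def emitHm : Com G := pourDbl G.hm G.rD ;; push G.rD false ;; push G.rD true

/-- **Effect of `emitHm`** (cost `4|hm| + 3`): `rD := (dbl hm ++ 01).reverse ++ rD`. [folklore] -/
theorem runs_emitHm (F : GF) :
    Runs emitHm F.get { F with hm := [], rD := (SProg.dbl F.hm ++ [false, true]).reverse ++ F.rD }.get (4 * F.hm.length + 3) := by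
  have h1 := runs_pourDbl (k := G.hm) (o := G.rD) (by decide) F.hm F.get rfl
  simp only [GF.get_rD, GF.update_hm, GF.update_rD] at h1
  have h2 := Runs.push G.rD false ({ F with hm := [], rD := SProg.dbl F.hm.reverse ++ F.rD } : GF).get
  simp only [GF.get_rD, GF.update_rD] at h2
  have h3 := Runs.push G.rD true ({ F with hm := [], rD := false :: (SProg.dbl F.hm.reverse ++ F.rD) } : GF).get
  simp only [GF.get_rD, GF.update_rD] at h3
  refine (h1.seq (h2.seq h3)).of_eq ?_ (by omega)
  simp [List.reverse_append, reverse_dbl]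

/-! #### The walk over the skipped entries -/

/-- One skipped entry: split it off `ents` (restoring the rest), bring it in order (`e2`), emit it
doubled with its separator into `rD`. [folklore] -/
def stepS : Com G :=
  unpairW G.ents G.e G.Tt G.M G.P ;; pour G.Tt G.ents ;; clear G.M ;; pour G.e G.e2 ;; pourDbl G.e2 G.rD ;;
    push G.rD false ;; push G.rD true

/-- **Effect of `stepS`** (cost `≤ 17|ents| + 16`). [folklore] -/
theorem runs_stepS (F : GF) :
    Runs stepS { F with e := [], e2 := [], Tt := [], M := [], P := [] }.get
      { F with ents := (boolUnpair F.ents).2, rD := (SProg.dbl (boolUnpair F.ents).1 ++ [false, true]).reverse ++ F.rD, e := [], e2 := [], Tt := [], M := [], P := [] }.get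
      (17 * F.ents.length + 16) := by
  have hlen := length_boolUnpair_parts_le F.ents
  have h1 := runs_unpairW (k := G.ents) (a := G.e) (t := G.Tt) (M := G.M) (P := G.P) (by decide)
    ({ F with e := [], e2 := [], Tt := [], M := [], P := [] } : GF).get rfl rfl
  simp only [GF.get_ents, GF.get_e, GF.get_Tt, GF.update_ents, GF.update_e, GF.update_Tt, GF.update_M, GF.update_P,
    List.append_nil] at h1
  have h2 := runs_pour (a := G.Tt) (b := G.ents) (by decide)
    ({ F with ents := [], e := (boolUnpair F.ents).1.reverse, e2 := [], Tt := (boolUnpair F.ents).2.reverse, M := flag (wellPaired F.ents), P := [] } : GF).get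
  simp only [GF.get_Tt, GF.get_ents, GF.update_Tt, GF.update_ents, List.reverse_reverse, List.append_nil,
    List.length_reverse] at h2
  have h3 := runs_clear G.M
    ({ F with ents := (boolUnpair F.ents).2, e := (boolUnpair F.ents).1.reverse, e2 := [], Tt := [], M := flag (wellPaired F.ents), P := [] } : GF).get
  simp only [GF.get_M, GF.update_M] at h3
  have hfl := length_flag_le (wellPaired F.ents)
  have h4 := runs_pour (a := G.e) (b := G.e2) (by decide)
    ({ F with ents := (boolUnpair F.ents).2, e := (boolUnpair F.ents).1.reverse, e2 := [], Tt := [], M := [], P := [] } : GF).get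
  simp only [GF.get_e, GF.get_e2, GF.update_e, GF.update_e2, List.reverse_reverse, List.append_nil,
    List.length_reverse] at h4
  have h5 := runs_pourDbl (k := G.e2) (o := G.rD) (by decide) (boolUnpair F.ents).1
    ({ F with ents := (boolUnpair F.ents).2, e := [], e2 := (boolUnpair F.ents).1, Tt := [], M := [], P := [] } : GF).get rfl
  simp only [GF.get_rD, GF.update_e2, GF.update_rD] at h5
  have h6 := Runs.push G.rD false
    ({ F with ents := (boolUnpair F.ents).2, e := [], e2 := [], rD := SProg.dbl (boolUnpair F.ents).1.reverse ++ F.rD, Tt := [], M := [], P := [] } : GF).get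
  simp only [GF.get_rD, GF.update_rD] at h6
  have h7 := Runs.push G.rD true
    ({ F with ents := (boolUnpair F.ents).2, e := [], e2 := [], rD := false :: (SProg.dbl (boolUnpair F.ents).1.reverse ++ F.rD), Tt := [], M := [], P := [] } : GF).get
  simp only [GF.get_rD, GF.update_rD] at h7
  refine (h1.seq (h2.seq (h3.seq (h4.seq (h5.seq (h6.seq h7)))))).of_eq ?_ (by omega)
  simp [List.reverse_append, reverse_dbl]

/-- The walk over the skipped entries, counted by `sU`. [folklore] -/
def walkS : Com G := loop G.sU stepS stepS

/-- **Effect of `walkS`** (cost `≤ (17 N + 18)|sU| + 1` when `|ents| ≤ N`). [folklore] -/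
theorem runs_walkS (F : GF) (N : ℕ) (hN : F.ents.length ≤ N) (v : List Bool) :
    Runs walkS { F with sU := v, e := [], e2 := [], Tt := [], M := [], P := [] }.get
      { F with sU := [], ents := unp2It v.length F.ents, rD := (emitS v.length F.ents).reverse ++ F.rD, e := [], e2 := [], Tt := [], M := [], P := [] }.get
      ((17 * N + 18) * v.length + 1) := by
  set Φ : ℕ → Regs G := fun i =>
    ({ F with sU := [], ents := unp2It i F.ents, rD := (emitS i F.ents).reverse ++ F.rD, e := [], e2 := [], Tt := [], M := [], P := [] } : GF).get with hΦ
  have hΦc : ∀ i, Φ i G.sU = [] := fun i => rfl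
  have h := runs_indexLoop (c := G.sU) (body := stepS) Φ (17 * N + 16) hΦc v 0 ?_
  · simp only [Nat.zero_add] at h
    refine h.of_eq' ?_ ?_ (le_of_eq (by ring))
    · simp [hΦ, unp2It, emitS]
    · simp [hΦ]
  · intro i _ _ w
    have hb := runs_stepS { F with sU := w, ents := unp2It i F.ents, rD := (emitS i F.ents).reverse ++ F.rD }
    dsimp only at hb
    have hlen : (unp2It i F.ents).length ≤ N := (length_unp2It_le i F.ents).trans hN
    refine hb.of_eq' ?_ ?_ (by omega)
    · simp [hΦ]
    · simp only [hΦ, GF.update_sU, emitS_succ', unp2It_succ', List.reverse_append, List.append_assoc]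

/-! #### The walk over the doubled entries -/

/-- First half of a doubled entry: split it off `ents`, bring it in order (`e2`), and emit a copy
doubled with its separator into the row buffer `rRow`. [folklore] -/
def stepC1 : Com G :=
  unpairW G.ents G.e G.Tt G.M G.P ;; pour G.Tt G.ents ;; clear G.M ;; pour G.e G.e2 ;; copy G.e2 G.e3 G.t1 G.t2 ;;
    pourDbl G.e3 G.rRow ;; push G.rRow false ;; push G.rRow true

/-- **Effect of `stepC1`** (cost `≤ 27|ents| + 19`). [folklore] -/
theorem runs_stepC1 (F : GF) :
    Runs stepC1 { F with e := [], e2 := [], e3 := [], Tt := [], M := [], P := [], t1 := [], t2 := [] }.get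
      { F with ents := (boolUnpair F.ents).2, e2 := (boolUnpair F.ents).1, rRow := (SProg.dbl (boolUnpair F.ents).1 ++ [false, true]).reverse ++ F.rRow, e := [], e3 := [], Tt := [], M := [], P := [], t1 := [], t2 := [] }.get
      (27 * F.ents.length + 19) := by
  have hlen := length_boolUnpair_parts_le F.ents
  have h1 := runs_unpairW (k := G.ents) (a := G.e) (t := G.Tt) (M := G.M) (P := G.P) (by decide)
    ({ F with e := [], e2 := [], e3 := [], Tt := [], M := [], P := [], t1 := [], t2 := [] } : GF).get rfl rfl
  simp only [GF.get_ents, GF.get_e, GF.get_Tt, GF.update_ents, GF.update_e, GF.update_Tt, GF.update_M, GF.update_P,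
    List.append_nil] at h1
  have h2 := runs_pour (a := G.Tt) (b := G.ents) (by decide)
    ({ F with ents := [], e := (boolUnpair F.ents).1.reverse, e2 := [], e3 := [], Tt := (boolUnpair F.ents).2.reverse, M := flag (wellPaired F.ents), P := [], t1 := [], t2 := [] } : GF).get
  simp only [GF.get_Tt, GF.get_ents, GF.update_Tt, GF.update_ents, List.reverse_reverse, List.append_nil,
    List.length_reverse] at h2
  have h3 := runs_clear G.M
    ({ F with ents := (boolUnpair F.ents).2, e := (boolUnpair F.ents).1.reverse, e2 := [], e3 := [], Tt := [], M := flag (wellPaired F.ents), P := [], t1 := [], t2 := [] } : GF).get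
  simp only [GF.get_M, GF.update_M] at h3
  have hfl := length_flag_le (wellPaired F.ents)
  have h4 := runs_pour (a := G.e) (b := G.e2) (by decide)
    ({ F with ents := (boolUnpair F.ents).2, e := (boolUnpair F.ents).1.reverse, e2 := [], e3 := [], Tt := [], M := [], P := [], t1 := [], t2 := [] } : GF).get
  simp only [GF.get_e, GF.get_e2, GF.update_e, GF.update_e2, List.reverse_reverse, List.append_nil,
    List.length_reverse] at h4
  have h5 := runs_copy (a := G.e2) (b := G.e3) (t := G.t1) (u := G.t2) (by decide) (by decide) (by decide)
    (by decide) (by decide) (by decide)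
    ({ F with ents := (boolUnpair F.ents).2, e := [], e2 := (boolUnpair F.ents).1, e3 := [], Tt := [], M := [], P := [], t1 := [], t2 := [] } : GF).get rfl rfl
  simp only [GF.get_e2, GF.get_e3, GF.update_e3, List.append_nil] at h5
  have h6 := runs_pourDbl (k := G.e3) (o := G.rRow) (by decide) (boolUnpair F.ents).1
    ({ F with ents := (boolUnpair F.ents).2, e := [], e2 := (boolUnpair F.ents).1, e3 := (boolUnpair F.ents).1, Tt := [], M := [], P := [], t1 := [], t2 := [] } : GF).get rfl
  simp only [GF.get_rRow, GF.update_e3, GF.update_rRow] at h6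
  have h7 := Runs.push G.rRow false
    ({ F with ents := (boolUnpair F.ents).2, e := [], e2 := (boolUnpair F.ents).1, e3 := [], rRow := SProg.dbl (boolUnpair F.ents).1.reverse ++ F.rRow, Tt := [], M := [], P := [], t1 := [], t2 := [] } : GF).get
  simp only [GF.get_rRow, GF.update_rRow] at h7
  have h8 := Runs.push G.rRow true
    ({ F with ents := (boolUnpair F.ents).2, e := [], e2 := (boolUnpair F.ents).1, e3 := [], rRow := false :: (SProg.dbl (boolUnpair F.ents).1.reverse ++ F.rRow), Tt := [], M := [], P := [], t1 := [], t2 := [] } : GF).get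
  simp only [GF.get_rRow, GF.update_rRow] at h8
  refine (h1.seq (h2.seq (h3.seq (h4.seq (h5.seq (h6.seq (h7.seq h8))))))).of_eq ?_ (by omega)
  simp [List.reverse_append, reverse_dbl]

/-- The new low-order bit of a doubled magnitude (`00`, doubled), unless the magnitude is `0`.
[folklore] -/
def lowBit : Com G :=
  pop G.e3 (push G.e3 true ;; push G.rD false ;; push G.rD false) (push G.e3 false ;; push G.rD false ;; push G.rD false) skip

/-- The two extra symbols for a nonzero magnitude. [folklore] -/
def lowBits : List Bool → List Bool
  | [] => []
  | _ :: _ => [false, false]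

/-- **Effect of `lowBit`** (cost `≤ 5`). [folklore] -/
theorem runs_lowBit (F : GF) (v : List Bool) :
    Runs lowBit { F with e3 := v }.get { F with e3 := v, rD := lowBits v ++ F.rD }.get 5 := by
  rcases v with _ | ⟨b, v⟩
  · refine (Runs.pop_nil _ _ (k := G.e3) rfl (Runs.skip _)).of_eq ?_ (by norm_num)
    rfl
  · have hk : ({ F with e3 := b :: v } : GF).get G.e3 = b :: v := rfl
    have hupd : Function.update ({ F with e3 := b :: v } : GF).get G.e3 v = ({ F with e3 := v } : GF).get := by simp
    have hbody : ∀ c : Bool, Runs (push G.e3 c ;; push G.rD false ;; push G.rD false) ({ F with e3 := v } : GF).get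
        ({ F with e3 := c :: v, rD := false :: false :: F.rD } : GF).get 3 := by
      intro c
      have h1 := Runs.push G.e3 c ({ F with e3 := v } : GF).get
      simp only [GF.get_e3, GF.update_e3] at h1
      have h2 := Runs.push G.rD false ({ F with e3 := c :: v } : GF).get
      simp only [GF.get_rD, GF.update_rD] at h2
      have h3 := Runs.push G.rD false ({ F with e3 := c :: v, rD := false :: F.rD } : GF).get
      simp only [GF.get_rD, GF.update_rD] at h3
      exact (h1.seq (h2.seq h3)).of_eq rfl le_rfl
    cases b
    · exact (Runs.pop_false' _ _ hk hupd (hbody false)).of_eq rfl (by norm_num)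
    · exact (Runs.pop_true' _ _ hk hupd (hbody true)).of_eq rfl (by norm_num)

/-- Second half of a doubled entry: split the entry `e2 = ⟨sgn, mag⟩`, emit `sgn` fourfold, the
doubled separator `0011`, the new low bit `00` (if `mag ≠ []`), `mag` doubled, and the frame
separator `01` into `rD`. [folklore] -/
def stepC2 : Com G :=
  unpairW G.e2 G.sg G.Tt G.M G.P ;; clear G.M ;; pour G.sg G.e3 ;; pourRep G.e3 G.rD 4 ;;
    push G.rD false ;; push G.rD false ;; push G.rD true ;; push G.rD true ;; pour G.Tt G.e3 ;; lowBit ;;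
    pourDbl G.e3 G.rD ;; push G.rD false ;; push G.rD true

/-- The piece emitted into `rD` by `stepC2` for the entry `e`. [folklore] -/
def pieceC (e : List Bool) : List Bool :=
  repBits 4 (boolUnpair e).1 ++ [false, false, true, true] ++ (lowBits (boolUnpair e).2 ++ SProg.dbl (boolUnpair e).2) ++ [false, true]

/-- The piece is the doubled `dblInt` code with its frame separator. [folklore] -/
theorem pieceC_eq (e : List Bool) : pieceC e = SProg.dbl (dblInt e) ++ [false, true] := by
  rw [pieceC, dbl_dblInt]
  cases (boolUnpair e).2 <;> simp [lowBits]

/-- **Effect of `stepC2`** (cost `≤ 24|e2| + 30`). [folklore] -/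
theorem runs_stepC2 (F : GF) :
    Runs stepC2 { F with sg := [], e3 := [], Tt := [], M := [], P := [] }.get
      { F with e2 := [], rD := (pieceC F.e2).reverse ++ F.rD, sg := [], e3 := [], Tt := [], M := [], P := [] }.get
      (24 * F.e2.length + 30) := by
  have hlen := length_boolUnpair_parts_le F.e2
  set sgn := (boolUnpair F.e2).1 with hsgn
  set mag := (boolUnpair F.e2).2 with hmag
  have h1 := runs_unpairW (k := G.e2) (a := G.sg) (t := G.Tt) (M := G.M) (P := G.P) (by decide)
    ({ F with sg := [], e3 := [], Tt := [], M := [], P := [] } : GF).get rfl rfl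
  simp only [GF.get_e2, GF.get_sg, GF.get_Tt, GF.update_e2, GF.update_sg, GF.update_Tt, GF.update_M, GF.update_P,
    List.append_nil, ← hsgn, ← hmag] at h1
  have h2 := runs_clear G.M
    ({ F with e2 := [], sg := sgn.reverse, e3 := [], Tt := mag.reverse, M := flag (wellPaired F.e2), P := [] } : GF).get
  simp only [GF.get_M, GF.update_M] at h2
  have hfl := length_flag_le (wellPaired F.e2)
  have h3 := runs_pour (a := G.sg) (b := G.e3) (by decide)
    ({ F with e2 := [], sg := sgn.reverse, e3 := [], Tt := mag.reverse, M := [], P := [] } : GF).get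
  simp only [GF.get_sg, GF.get_e3, GF.update_sg, GF.update_e3, List.reverse_reverse, List.append_nil,
    List.length_reverse] at h3
  have h4 := runs_pourRep (k := G.e3) (o := G.rD) (by decide) 4 sgn
    ({ F with e2 := [], sg := [], e3 := sgn, Tt := mag.reverse, M := [], P := [] } : GF).get rfl
  simp only [GF.get_rD, GF.update_e3, GF.update_rD] at h4
  set R4 := repBits 4 sgn.reverse ++ F.rD with hR4
  have h5 := Runs.push G.rD false ({ F with e2 := [], sg := [], e3 := [], rD := R4, Tt := mag.reverse, M := [], P := [] } : GF).get
  simp only [GF.get_rD, GF.update_rD] at h5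
  have h6 := Runs.push G.rD false ({ F with e2 := [], sg := [], e3 := [], rD := false :: R4, Tt := mag.reverse, M := [], P := [] } : GF).get
  simp only [GF.get_rD, GF.update_rD] at h6
  have h7 := Runs.push G.rD true ({ F with e2 := [], sg := [], e3 := [], rD := false :: false :: R4, Tt := mag.reverse, M := [], P := [] } : GF).get
  simp only [GF.get_rD, GF.update_rD] at h7
  have h8 := Runs.push G.rD true ({ F with e2 := [], sg := [], e3 := [], rD := true :: false :: false :: R4, Tt := mag.reverse, M := [], P := [] } : GF).get
  simp only [GF.get_rD, GF.update_rD] at h8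
  set R8 := true :: true :: false :: false :: R4 with hR8
  have h9 := runs_pour (a := G.Tt) (b := G.e3) (by decide)
    ({ F with e2 := [], sg := [], e3 := [], rD := R8, Tt := mag.reverse, M := [], P := [] } : GF).get
  simp only [GF.get_Tt, GF.get_e3, GF.update_Tt, GF.update_e3, List.reverse_reverse, List.append_nil,
    List.length_reverse] at h9
  have h10 := runs_lowBit { F with e2 := [], sg := [], rD := R8, Tt := [], M := [], P := [] } mag
  dsimp only at h10
  have h11 := runs_pourDbl (k := G.e3) (o := G.rD) (by decide) mag
    ({ F with e2 := [], sg := [], e3 := mag, rD := lowBits mag ++ R8, Tt := [], M := [], P := [] } : GF).get rfl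
  simp only [GF.get_rD, GF.update_e3, GF.update_rD] at h11
  have h12 := Runs.push G.rD false ({ F with e2 := [], sg := [], e3 := [], rD := SProg.dbl mag.reverse ++ (lowBits mag ++ R8), Tt := [], M := [], P := [] } : GF).get
  simp only [GF.get_rD, GF.update_rD] at h12
  have h13 := Runs.push G.rD true ({ F with e2 := [], sg := [], e3 := [], rD := false :: (SProg.dbl mag.reverse ++ (lowBits mag ++ R8)), Tt := [], M := [], P := [] } : GF).get
  simp only [GF.get_rD, GF.update_rD] at h13
  have hsl : sgn.length ≤ F.e2.length := by omega
  have hml : mag.length ≤ F.e2.length := by omega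
  refine (h1.seq (h2.seq (h3.seq (h4.seq (h5.seq (h6.seq (h7.seq (h8.seq (h9.seq (h10.seq (h11.seq (h12.seq h13)))))))))))).of_eq ?_ (by omega)
  have hlow : (lowBits mag).reverse = lowBits mag := by cases mag <;> rfl
  simp [hR8, hR4, pieceC, ← hsgn, ← hmag, List.reverse_append, reverse_dbl, reverse_repBits, hlow]

/-- One doubled entry: both halves. [folklore] -/
def stepC : Com G := stepC1 ;; stepC2

/-- **Effect of `stepC`** (cost `≤ 51|ents| + 49`). [folklore] -/
theorem runs_stepC (F : GF) :
    Runs stepC { F with e := [], e2 := [], e3 := [], sg := [], Tt := [], M := [], P := [], t1 := [], t2 := [] }.get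
      { F with ents := (boolUnpair F.ents).2, rRow := (SProg.dbl (boolUnpair F.ents).1 ++ [false, true]).reverse ++ F.rRow, rD := (pieceC (boolUnpair F.ents).1).reverse ++ F.rD, e := [], e2 := [], e3 := [], sg := [], Tt := [], M := [], P := [], t1 := [], t2 := [] }.get
      (51 * F.ents.length + 49) := by
  have hlen := length_boolUnpair_parts_le F.ents
  have h1 := runs_stepC1 { F with sg := [] }
  dsimp only at h1
  have h2 := runs_stepC2 { F with ents := (boolUnpair F.ents).2, e2 := (boolUnpair F.ents).1, rRow := (SProg.dbl (boolUnpair F.ents).1 ++ [false, true]).reverse ++ F.rRow, e := [], t1 := [], t2 := [] }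
  dsimp only at h2
  exact (h1.seq h2).of_eq rfl (by omega)

/-- The walk over the doubled entries, counted by `cU`. [folklore] -/
def walkC : Com G := loop G.cU stepC stepC

/-- **Effect of `walkC`** (cost `≤ (51 N + 51)|cU| + 1` when `|ents| ≤ N`). [folklore] -/
theorem runs_walkC (F : GF) (N : ℕ) (hN : F.ents.length ≤ N) (v : List Bool) :
    Runs walkC { F with cU := v, e := [], e2 := [], e3 := [], sg := [], Tt := [], M := [], P := [], t1 := [], t2 := [] }.get
      { F with cU := [], ents := unp2It v.length F.ents, rRow := (emitS v.length F.ents).reverse ++ F.rRow, rD := (emitC v.length F.ents).reverse ++ F.rD, e := [], e2 := [], e3 := [], sg := [], Tt := [], M := [], P := [], t1 := [], t2 := [] }.get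
      ((51 * N + 51) * v.length + 1) := by
  set Φ : ℕ → Regs G := fun i =>
    ({ F with cU := [], ents := unp2It i F.ents, rRow := (emitS i F.ents).reverse ++ F.rRow, rD := (emitC i F.ents).reverse ++ F.rD, e := [], e2 := [], e3 := [], sg := [], Tt := [], M := [], P := [], t1 := [], t2 := [] } : GF).get with hΦ
  have hΦc : ∀ i, Φ i G.cU = [] := fun i => rfl
  have h := runs_indexLoop (c := G.cU) (body := stepC) Φ (51 * N + 49) hΦc v 0 ?_
  · simp only [Nat.zero_add] at h
    refine h.of_eq' ?_ ?_ (le_of_eq (by ring))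
    · simp [hΦ, unp2It, emitS, emitC]
    · simp [hΦ]
  · intro i _ _ w
    have hb := runs_stepC { F with cU := w, ents := unp2It i F.ents, rRow := (emitS i F.ents).reverse ++ F.rRow, rD := (emitC i F.ents).reverse ++ F.rD }
    dsimp only at hb
    have hlen : (unp2It i F.ents).length ≤ N := (length_unp2It_le i F.ents).trans hN
    refine hb.of_eq' ?_ ?_ (by omega)
    · simp [hΦ]
    · simp only [hΦ, GF.update_cU, emitS_succ', emitC_succ', unp2It_succ', List.reverse_append, List.append_assoc,
        pieceC_eq]

/-! #### Assembling the output -/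

/-- Emit the doubled separator `0011` into `r`. [folklore] -/
def sep4 (r : G) : Com G := push r false ;; push r false ;; push r true ;; push r true

/-- **Effect of `sep4 rO`**. [folklore] -/
theorem runs_sep4_rO (F : GF) : Runs (sep4 G.rO) F.get { F with rO := true :: true :: false :: false :: F.rO }.get 4 := by
  have h1 := Runs.push G.rO false F.get
  simp only [GF.get_rO, GF.update_rO] at h1
  have h2 := Runs.push G.rO false ({ F with rO := false :: F.rO } : GF).get
  simp only [GF.get_rO, GF.update_rO] at h2
  have h3 := Runs.push G.rO true ({ F with rO := false :: false :: F.rO } : GF).get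
  simp only [GF.get_rO, GF.update_rO] at h3
  have h4 := Runs.push G.rO true ({ F with rO := true :: false :: false :: F.rO } : GF).get
  simp only [GF.get_rO, GF.update_rO] at h4
  exact (h1.seq (h2.seq (h3.seq h4))).of_eq rfl le_rfl

/-- Assemble the output: tag bit, `nc` fourfold, `0011`, the matrix code fourfold, `0011`, the unary
dimension fourfold, `0011`, the row code doubled, `01`, `er`; then pour to `out`. [folklore] -/
def assemble : Com G :=
  push G.rO false ;; pour G.nk G.nc ;; pourRep G.nc G.rO 4 ;; sep4 G.rO ;; pour G.rD G.d2 ;; pourRep G.d2 G.rO 4 ;;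
    sep4 G.rO ;; pourRep G.nV G.rO 4 ;; sep4 G.rO ;; pour G.rRow G.d2 ;; pourDbl G.d2 G.rO ;; push G.rO false ;;
    push G.rO true ;; pour G.er G.rO ;; pour G.rO G.out

/-- The assembled string. [folklore] -/
def assembled (nc D U Rw er : List Bool) : List Bool :=
  false :: (repBits 4 nc ++ [false, false, true, true] ++ repBits 4 D ++ [false, false, true, true] ++ repBits 4 U ++
    [false, false, true, true] ++ repBits 2 Rw ++ [false, true] ++ er)

/-- **Effect of `assemble`** (cost `≤ 21 (|nk| + |rD| + |nV| + |rRow| + |er|) + 70`). [folklore] -/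
theorem runs_assemble (F : GF) :
    Runs assemble { F with rO := [], nc := [], d2 := [], out := [] }.get
      { F with rO := [], nc := [], d2 := [], nk := [], rD := [], nV := [], rRow := [], er := [], out := assembled F.nk.reverse F.rD.reverse F.nV F.rRow.reverse F.er }.get
      (21 * (F.nk.length + F.rD.length + F.nV.length + F.rRow.length + F.er.length) + 70) := by
  have h1 := Runs.push G.rO false ({ F with rO := [], nc := [], d2 := [], out := [] } : GF).get
  simp only [GF.get_rO, GF.update_rO] at h1
  have h2 := runs_pour (a := G.nk) (b := G.nc) (by decide) ({ F with rO := [false], nc := [], d2 := [], out := [] } : GF).get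
  simp only [GF.get_nk, GF.get_nc, GF.update_nk, GF.update_nc, List.append_nil] at h2
  have h3 := runs_pourRep (k := G.nc) (o := G.rO) (by decide) 4 F.nk.reverse
    ({ F with rO := [false], nc := F.nk.reverse, nk := [], d2 := [], out := [] } : GF).get rfl
  simp only [GF.get_rO, GF.update_nc, GF.update_rO, List.reverse_reverse] at h3
  set R3 := repBits 4 F.nk ++ [false] with hR3
  have h4 := runs_sep4_rO { F with rO := R3, nc := [], nk := [], d2 := [], out := [] }
  dsimp only at h4
  set R4 := true :: true :: false :: false :: R3 with hR4
  have h5 := runs_pour (a := G.rD) (b := G.d2) (by decide) ({ F with rO := R4, nc := [], nk := [], d2 := [], out := [] } : GF).get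
  simp only [GF.get_rD, GF.get_d2, GF.update_rD, GF.update_d2, List.append_nil] at h5
  have h6 := runs_pourRep (k := G.d2) (o := G.rO) (by decide) 4 F.rD.reverse
    ({ F with rO := R4, nc := [], nk := [], rD := [], d2 := F.rD.reverse, out := [] } : GF).get rfl
  simp only [GF.get_rO, GF.update_d2, GF.update_rO, List.reverse_reverse] at h6
  set R6 := repBits 4 F.rD ++ R4 with hR6
  have h7 := runs_sep4_rO { F with rO := R6, nc := [], nk := [], rD := [], d2 := [], out := [] }
  dsimp only at h7
  set R7 := true :: true :: false :: false :: R6 with hR7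
  have h8 := runs_pourRep (k := G.nV) (o := G.rO) (by decide) 4 F.nV
    ({ F with rO := R7, nc := [], nk := [], rD := [], d2 := [], out := [] } : GF).get rfl
  simp only [GF.get_rO, GF.update_nV, GF.update_rO] at h8
  set R8 := repBits 4 F.nV.reverse ++ R7 with hR8
  have h9 := runs_sep4_rO { F with rO := R8, nc := [], nk := [], rD := [], nV := [], d2 := [], out := [] }
  dsimp only at h9
  set R9 := true :: true :: false :: false :: R8 with hR9
  have h10 := runs_pour (a := G.rRow) (b := G.d2) (by decide) ({ F with rO := R9, nc := [], nk := [], rD := [], nV := [], d2 := [], out := [] } : GF).get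
  simp only [GF.get_rRow, GF.get_d2, GF.update_rRow, GF.update_d2, List.append_nil] at h10
  have h11 := runs_pourDbl (k := G.d2) (o := G.rO) (by decide) F.rRow.reverse
    ({ F with rO := R9, nc := [], nk := [], rD := [], nV := [], rRow := [], d2 := F.rRow.reverse, out := [] } : GF).get rfl
  simp only [GF.get_rO, GF.update_d2, GF.update_rO, List.reverse_reverse] at h11
  set R11 := SProg.dbl F.rRow ++ R9 with hR11
  have h12 := Runs.push G.rO false ({ F with rO := R11, nc := [], nk := [], rD := [], nV := [], rRow := [], d2 := [], out := [] } : GF).get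
  simp only [GF.get_rO, GF.update_rO] at h12
  have h13 := Runs.push G.rO true ({ F with rO := false :: R11, nc := [], nk := [], rD := [], nV := [], rRow := [], d2 := [], out := [] } : GF).get
  simp only [GF.get_rO, GF.update_rO] at h13
  have h14 := runs_pour (a := G.er) (b := G.rO) (by decide) ({ F with rO := true :: false :: R11, nc := [], nk := [], rD := [], nV := [], rRow := [], d2 := [], out := [] } : GF).get
  simp only [GF.get_er, GF.get_rO, GF.update_er, GF.update_rO] at h14
  set R14 := F.er.reverse ++ true :: false :: R11 with hR14
  have h15 := runs_pour (a := G.rO) (b := G.out) (by decide) ({ F with rO := R14, nc := [], nk := [], rD := [], nV := [], rRow := [], er := [], d2 := [], out := [] } : GF).get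
  simp only [GF.get_rO, GF.get_out, GF.update_rO, GF.update_out, List.append_nil] at h15
  have hl3 : R3.length = 4 * F.nk.length + 1 := by simp [hR3, length_repBits]
  have hl6 : R6.length = 4 * F.rD.length + R4.length := by simp [hR6, length_repBits]
  have hl8 : R8.length = 4 * F.nV.length + R7.length := by simp [hR8, length_repBits]
  have hl11 : R11.length = 2 * F.rRow.length + R9.length := by simp [hR11, dbl_eq_repBits, length_repBits]
  have hl14 : R14.length = F.er.length + 2 + R11.length := by simp [hR14]; omega
  have hl4 : R4.length = R3.length + 4 := by simp [hR4]
  have hl7 : R7.length = R6.length + 4 := by simp [hR7]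
  have hl9 : R9.length = R8.length + 4 := by simp [hR9]
  refine (h1.seq (h2.seq (h3.seq (h4.seq (h5.seq (h6.seq (h7.seq (h8.seq (h9.seq (h10.seq (h11.seq (h12.seq
    (h13.seq (h14.seq h15)))))))))))))).of_eq ?_ ?_
  · simp [hR14, hR11, hR9, hR8, hR7, hR6, hR4, hR3, assembled, List.reverse_append, reverse_repBits, dbl_eq_repBits]
  · simp only [List.length_reverse]
    omega

/-! #### The string identity -/

/-- The query as the assembled flat string. [folklore] -/
theorem assembled_eq_query (x : List Bool) (j n : ℕ) :
    assembled (boolUnpair (boolUnpair x).1).1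
      (boolPair (boolUnpair (boolUnpair (boolUnpair x).1).2).1 (dblEnts (j * n) n (boolUnpair (boolUnpair (boolUnpair x).1).2).2))
      (ones n) (rowEnts (j * n) n (boolUnpair (boolUnpair (boolUnpair x).1).2).2) (boolUnpair x).2 =
    false :: query x j n := by
  rw [query, unaryEncodeNat_eq_replicate]
  simp only [assembled, boolPair_eq, repBits_append, repBits_repBits, Nat.reduceMul, repBits_cons,
    List.replicate, List.append_assoc, List.cons_append, List.nil_append]

/-! #### Lengths of the emitted pieces -/

/-- Length of `emitS`. [folklore] -/
theorem length_emitS_le : ∀ (k : ℕ) (w : List Bool), (emitS k w).length + (unp2It k w).length ≤ w.length + 2 * k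
  | 0, w => by simp [emitS, unp2It]
  | k + 1, w => by
    have ih := length_emitS_le k (boolUnpair w).2
    have hl := length_boolUnpair_parts_le w
    simp only [emitS, unp2It, List.length_append, List.length_cons, List.length_nil, dbl_eq_repBits, length_repBits]
    omega

/-- Length of `pieceC`. [folklore] -/
theorem length_pieceC_le (e : List Bool) : (pieceC e).length ≤ 2 * e.length + 8 := by
  have hl := length_boolUnpair_parts_le e
  have hlow : (lowBits (boolUnpair e).2).length ≤ 2 := by cases (boolUnpair e).2 <;> simp [lowBits]
  simp only [pieceC, List.length_append, length_repBits, List.length_cons, List.length_nil, dbl_eq_repBits]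
  omega

/-- Length of `emitC`. [folklore] -/
theorem length_emitC_le : ∀ (k : ℕ) (w : List Bool), (emitC k w).length + (unp2It k w).length ≤ w.length + 8 * k
  | 0, w => by simp [emitC, unp2It]
  | k + 1, w => by
    have ih := length_emitC_le k (boolUnpair w).2
    have hl := length_boolUnpair_parts_le w
    have hp := length_pieceC_le (boolUnpair w).1
    rw [emitC, ← pieceC_eq]
    simp only [unp2It, List.length_append]
    omega

/-! #### Brick 4 -/

/-- Brick 4: the next query. [folklore] -/
def brick4 : Com G :=
  prelude ;; splitT ;; onesOf G.A G.jU ;; mulReg G.nU G.jU G.sU G.t1 ;; copy G.nU G.cU G.t1 G.t2 ;;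
    copy G.nU G.nV G.t1 G.t2 ;; splitMc ;; emitHm ;; walkS ;; walkC ;; pour G.ents G.rD ;; assemble

/-- **Effect of brick 4**: `out = false :: query x (tlen T) (dimOf x)`. [folklore] -/
theorem runs_brick4 (a b : List Bool) :
    ∃ R', Runs brick4 (Brick.init2 G.x G.tr a b) R' (1000 * (a.length + b.length + 1) ^ 3) ∧
      R' G.out = false :: query a (tlen b) (dimOf a) := by
  rw [init2_eq]
  -- names
  set n := dimOf a with hn
  set j := tlen b with hj
  set nc := (boolUnpair (boolUnpair a).1).1 with hnc
  set mc := (boolUnpair (boolUnpair a).1).2 with hmc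
  set er := (boolUnpair a).2 with her
  set hm := (boolUnpair mc).1 with hhm
  set E0 := (boolUnpair mc).2 with hE0
  set E1 := unp2It (j * n) E0 with hE1
  set E2 := unp2It n E1 with hE2
  have hla := length_boolUnpair_parts_le a
  have hlb := length_boolUnpair_parts_le b
  have hli := length_boolUnpair_parts_le (boolUnpair a).1
  have hlm := length_boolUnpair_parts_le mc
  have hnle : n ≤ a.length := dimOf_le a
  have hjle : j ≤ b.length := by rw [hj, tlen]; omega
  have hmcle : mc.length ≤ a.length := by rw [hmc]; omega
  have hE0le : E0.length ≤ a.length := by rw [hE0]; omega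
  have hE1le : E1.length ≤ a.length := (length_unp2It_le _ _).trans hE0le
  -- phases
  have h1 := runs_prelude a b
  rw [preF] at h1
  have h2 := runs_splitT ({ tr := b, K := ones a.length, er := er, nk := nc.reverse, mc := mc, nU := ones n } : GF)
  dsimp only at h2
  have hjA : (boolUnpair b).1.reverse.length = j := by rw [List.length_reverse, hj, tlen]
  have h3 := runs_onesOf (k := G.A) (u := G.jU) (by decide) (boolUnpair b).1.reverse
    ({ tr := (boolUnpair b).2, A := (boolUnpair b).1.reverse, K := ones a.length, er := er, nk := nc.reverse, mc := mc, nU := ones n } : GF).get rfl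
  simp only [GF.get_jU, GF.update_A, GF.update_jU, hjA, List.append_nil] at h3
  have h4 := runs_mulReg (n := G.nU) (a := G.jU) (a2 := G.sU) (t := G.t1) (by decide) (by decide) (by decide) (by decide)
    (by decide) (by decide) n j
    ({ tr := (boolUnpair b).2, K := ones a.length, er := er, nk := nc.reverse, mc := mc, nU := ones n, jU := ones j } : GF).get rfl rfl rfl
  simp only [GF.get_sU, GF.update_jU, GF.update_sU, List.append_nil] at h4
  have h5 := runs_copy (a := G.nU) (b := G.cU) (t := G.t1) (u := G.t2) (by decide) (by decide) (by decide)
    (by decide) (by decide) (by decide)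
    ({ tr := (boolUnpair b).2, K := ones a.length, er := er, nk := nc.reverse, mc := mc, nU := ones n, sU := ones (j * n) } : GF).get rfl rfl
  simp only [GF.get_nU, GF.get_cU, GF.update_cU, List.append_nil, length_ones] at h5
  have h6 := runs_copy (a := G.nU) (b := G.nV) (t := G.t1) (u := G.t2) (by decide) (by decide) (by decide)
    (by decide) (by decide) (by decide)
    ({ tr := (boolUnpair b).2, K := ones a.length, er := er, nk := nc.reverse, mc := mc, nU := ones n, sU := ones (j * n), cU := ones n } : GF).get rfl rfl
  simp only [GF.get_nU, GF.get_nV, GF.update_nV, List.append_nil, length_ones] at h6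
  have h7 := runs_splitMc ({ tr := (boolUnpair b).2, K := ones a.length, er := er, nk := nc.reverse, mc := mc, nU := ones n, sU := ones (j * n), cU := ones n, nV := ones n } : GF)
  dsimp only at h7
  rw [← hhm, ← hE0] at h7
  have h8 := runs_emitHm ({ tr := (boolUnpair b).2, K := ones a.length, er := er, nk := nc.reverse, nU := ones n, sU := ones (j * n), cU := ones n, nV := ones n, ents := E0, hm := hm } : GF)
  dsimp only at h8
  simp only [List.append_nil] at h8
  set D0 := (SProg.dbl hm ++ [false, true]).reverse with hD0
  have h9 := runs_walkS ({ tr := (boolUnpair b).2, K := ones a.length, er := er, nk := nc.reverse, nU := ones n, cU := ones n, nV := ones n, ents := E0, rD := D0 } : GF) a.length hE0le (ones (j * n))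
  dsimp only at h9
  simp only [length_ones] at h9
  rw [← hE1] at h9
  set D1 := (emitS (j * n) E0).reverse ++ D0 with hD1
  have h10 := runs_walkC ({ tr := (boolUnpair b).2, K := ones a.length, er := er, nk := nc.reverse, nU := ones n, nV := ones n, ents := E1, rD := D1 } : GF) a.length hE1le (ones n)
  dsimp only at h10
  simp only [length_ones, List.append_nil] at h10
  rw [← hE2] at h10
  set D2 := (emitC n E1).reverse ++ D1 with hD2
  set RW := (emitS n E1).reverse with hRW
  have h11 := runs_pour (a := G.ents) (b := G.rD) (by decide)
    ({ tr := (boolUnpair b).2, K := ones a.length, er := er, nk := nc.reverse, nU := ones n, nV := ones n, ents := E2, rRow := RW, rD := D2 } : GF).get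
  simp only [GF.get_ents, GF.get_rD, GF.update_ents, GF.update_rD] at h11
  set D3 := E2.reverse ++ D2 with hD3
  have h12 := runs_assemble ({ tr := (boolUnpair b).2, K := ones a.length, er := er, nk := nc.reverse, nU := ones n, nV := ones n, rRow := RW, rD := D3 } : GF)
  dsimp only at h12
  -- the output
  have hD3r : D3.reverse = boolPair hm (dblEnts (j * n) n E0) := by
    simp [hD3, hD2, hD1, hD0, boolPair_eq_dbl hm, dblEnts_eq, ← hE1, ← hE2, List.reverse_append]
  have hRWr : RW.reverse = rowEnts (j * n) n E0 := by rw [hRW, List.reverse_reverse, rowEnts_eq, ← hE1]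
  have hout : assembled nc.reverse.reverse D3.reverse (ones n) RW.reverse er = false :: query a j n := by
    rw [List.reverse_reverse, hD3r, hRWr, hnc, hhm, hE0, hmc, her]
    exact assembled_eq_query a j n
  rw [hout] at h12
  -- lengths for the budget
  have hE2le : E2.length ≤ a.length := (length_unp2It_le _ _).trans hE1le
  have hD3le : D3.length ≤ 6 * a.length + 2 * (j * n) + 8 * n + 2 := by
    have h₁ := length_emitS_le (j * n) E0
    have h₂ := length_emitC_le n E1
    rw [← hE1] at h₁
    rw [← hE2] at h₂
    have hhmle : hm.length ≤ a.length := by rw [hhm]; omega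
    simp only [hD3, hD2, hD1, hD0, List.length_append, List.length_reverse, List.length_cons, List.length_nil,
      dbl_eq_repBits, length_repBits]
    omega
  have hRWle : RW.length ≤ a.length + 2 * n := by
    have h₁ := length_emitS_le n E1
    rw [hRW, List.length_reverse]; omega
  have hjn : j * n ≤ b.length * a.length := Nat.mul_le_mul hjle hnle
  refine ⟨_, (h1.seq (h2.seq (h3.seq (h4.seq (h5.seq (h6.seq (h7.seq (h8.seq (h9.seq (h10.seq (h11.seq h12))))))))))).of_eq rfl ?_,
    by simp⟩
  -- the budget
  simp only [List.length_reverse, length_ones]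
  set A := a.length with hA
  set B := b.length with hB
  have hhmle : hm.length ≤ A := by rw [hhm]; omega
  have hncle : nc.length ≤ A := by rw [hnc]; omega
  have herle : er.length ≤ A := by rw [her]; omega
  set M := A + B + 1 with hM
  set M2 := M * M with hM2
  set M3 := M2 * M with hM3
  have hAM : A ≤ M := by omega
  have hBM : B ≤ M := by omega
  have h1M : 1 ≤ M := by omega
  have hMM2 : M ≤ M2 := by rw [hM2]; exact Nat.le_mul_of_pos_right M h1M
  have hM2M3 : M2 ≤ M3 := by rw [hM3]; exact Nat.le_mul_of_pos_right M2 h1M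
  have hBA : B * A ≤ M2 := by rw [hM2]; exact Nat.mul_le_mul hBM hAM
  have hsq : (A + 1) ^ 2 ≤ M2 := by rw [sq, hM2]; exact Nat.mul_le_mul (by omega) (by omega)
  have hjnM : j * n ≤ M2 := hjn.trans hBA
  have t1 : j * (7 * n + 4) ≤ M * (11 * M) := Nat.mul_le_mul (hjle.trans hBM) (by omega)
  have t2 : (17 * A + 18) * (j * n) ≤ (35 * M) * M2 := Nat.mul_le_mul (by omega) hjnM
  have t3 : (51 * A + 51) * n ≤ (102 * M) * M := Nat.mul_le_mul (by omega) (hnle.trans hAM)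
  have e1 : M * (11 * M) = 11 * M2 := by rw [hM2]; ring
  have e2 : 35 * M * M2 = 35 * M3 := by rw [hM3]; ring
  have e3 : 102 * M * M = 102 * M2 := by rw [hM2]; ring
  have e4 : 1000 * M ^ 3 = 1000 * M3 := by rw [hM3, hM2]; ring
  rw [e1] at t1; rw [e2] at t2; rw [e3] at t3
  rw [e4]
  omega

/-! ### The step function in `FP` -/

/-- The one-bit tests and the query as string functions of the pair `⟨x, T⟩`. [folklore] -/
def zeroTestFn (w : List Bool) : List Bool := [decide (dimOf (boolUnpair w).1 = 0)]
/-- [folklore] -/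
def hasTestFn (w : List Bool) : List Bool := [thas (boolUnpair w).2]
/-- [folklore] -/
def doneTestFn (w : List Bool) : List Bool := [decide (dimOf (boolUnpair w).1 ≤ tlen (boolUnpair w).2)]
/-- [folklore] -/
def qFn (w : List Bool) : List Bool := false :: query (boolUnpair w).1 (tlen (boolUnpair w).2) (dimOf (boolUnpair w).1)

open Polynomial in
/-- Brick 1 packaged. [folklore] -/
theorem zeroTestFn_mem_FP : zeroTestFn ∈ FP := by
  refine Brick.binOp_mem_FP brick1 (ix := G.x) (iy := G.tr) (by decide) G.out (fun a _ => [decide (dimOf a = 0)])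
    (fun n => 200 * (n + 1) ^ 2 + 3) (200 * (X + 1) ^ 2 + 3) (fun n => by simp) (fun a b => ?_) (fun a b => ?_)
  · simp only [List.length_singleton, eval_add, eval_mul, eval_pow, eval_X, eval_ofNat]; nlinarith
  · obtain ⟨R', h, hout⟩ := runs_brick1 a b
    have := Nat.pow_le_pow_left (show a.length + 1 ≤ a.length + b.length + 1 by omega) 2
    exact ⟨R', h.mono (by omega), hout⟩

open Polynomial in
/-- Brick 2 packaged. [folklore] -/
theorem hasTestFn_mem_FP : hasTestFn ∈ FP := by
  refine Brick.binOp_mem_FP brick2 (ix := G.x) (iy := G.tr) (by decide) G.out (fun _ b => [thas b])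
    (fun n => 30 * (n + 1) ^ 2 + 3) (30 * (X + 1) ^ 2 + 3) (fun n => by simp) (fun a b => ?_) (fun a b => ?_)
  · simp only [List.length_singleton, eval_add, eval_mul, eval_pow, eval_X, eval_ofNat]; nlinarith
  · obtain ⟨R', h, hout⟩ := runs_brick2 a b
    have := Nat.pow_le_pow_left (show b.length + 1 ≤ a.length + b.length + 1 by omega) 2
    exact ⟨R', h.mono (by omega), hout⟩

open Polynomial in
/-- Brick 3 packaged. [folklore] -/
theorem doneTestFn_mem_FP : doneTestFn ∈ FP := by
  refine Brick.binOp_mem_FP brick3 (ix := G.x) (iy := G.tr) (by decide) G.out (fun a b => [decide (dimOf a ≤ tlen b)])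
    (fun n => 200 * (n + 1) ^ 2 + 14 * (n + 1) + 3) (200 * (X + 1) ^ 2 + 14 * (X + 1) + 3) (fun n => by simp)
    (fun a b => ?_) (fun a b => ?_)
  · simp only [List.length_singleton, eval_add, eval_mul, eval_pow, eval_X, eval_ofNat]; nlinarith
  · obtain ⟨R', h, hout⟩ := runs_brick3 a b
    have := Nat.pow_le_pow_left (show a.length + 1 ≤ a.length + b.length + 1 by omega) 2
    exact ⟨R', h.mono (by omega), hout⟩

/-- Length of the query. [folklore] -/
theorem length_query_le (x : List Bool) (j n : ℕ) (hn : n ≤ x.length) :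
    (query x j n).length ≤ 60 * (x.length + j * n + 1) := by
  have hla := length_boolUnpair_parts_le x
  have hli := length_boolUnpair_parts_le (boolUnpair x).1
  have hlm := length_boolUnpair_parts_le (boolUnpair (boolUnpair x).1).2
  have h₁ := length_emitS_le (j * n) (boolUnpair (boolUnpair (boolUnpair x).1).2).2
  have h₂ := length_emitC_le n (unp2It (j * n) (boolUnpair (boolUnpair (boolUnpair x).1).2).2)
  have h₃ := length_emitS_le n (unp2It (j * n) (boolUnpair (boolUnpair (boolUnpair x).1).2).2)
  have hu := length_unp2It_le (j * n) (boolUnpair (boolUnpair (boolUnpair x).1).2).2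
  simp only [query, length_boolPair, dblEnts_eq, rowEnts_eq, List.length_append, unaryEncodeNat_eq_replicate, length_ones]
  omega

open Polynomial in
/-- Brick 4 packaged. [folklore] -/
theorem qFn_mem_FP : qFn ∈ FP := by
  refine Brick.binOp_mem_FP brick4 (ix := G.x) (iy := G.tr) (by decide) G.out (fun a b => false :: query a (tlen b) (dimOf a))
    (fun n => 1000 * (n + 1) ^ 3) (1000 * (X + 1) ^ 3) (fun n => by simp) (fun a b => ?_) (fun a b => runs_brick4 a b)
  have hq := length_query_le a (tlen b) (dimOf a) (dimOf_le a)
  have hlb := length_boolUnpair_parts_le b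
  have hjn : tlen b * dimOf a ≤ b.length * a.length := Nat.mul_le_mul (by rw [tlen]; omega) (dimOf_le a)
  simp only [List.length_cons, eval_add, eval_mul, eval_pow, eval_X, eval_ofNat, eval_one]
  set L := a.length + b.length with hL
  have h1 : b.length * a.length ≤ (L + 1) * (L + 1) := Nat.mul_le_mul (by omega) (by omega)
  have h2 : (L + 1) * (L + 1) ≤ (L + 1) ^ 3 := by
    rw [pow_succ, sq]; exact Nat.le_mul_of_pos_right _ (by omega)
  have h3 : L + 1 ≤ (L + 1) * (L + 1) := Nat.le_mul_of_pos_right _ (by omega)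
  omega

/-- **The step function as a string function**: the three tests, then the query. [folklore] -/
noncomputable def gFn : List Bool → List Bool :=
  iteFn zeroTestFn (fun _ => [true, true]) (iteFn hasTestFn (fun _ => [true, true]) (iteFn doneTestFn (fun _ => [true, false]) qFn))

/-- `gFn ∈ FP`. [folklore] -/
theorem gFn_mem_FP : gFn ∈ FP :=
  iteFn_mem_FP zeroTestFn_mem_FP (const_mem_FP _)
    (iteFn_mem_FP hasTestFn_mem_FP (const_mem_FP _) (iteFn_mem_FP doneTestFn_mem_FP (const_mem_FP _) qFn_mem_FP))

/-- `gFn` computes the code of the syntactic step. [folklore] -/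
theorem gFn_boolPair (x T : List Bool) :
    gFn (boolPair x T) = ((encodingList Bool).sumBool encodingBoolBool).encode (gcore x T) := by
  rw [gFn, gcore]
  by_cases h1 : dimOf x = 0
  · rw [iteFn_apply_true (by simp [zeroTestFn, h1]), if_pos h1]; rfl
  rw [iteFn_apply_false (by simp [zeroTestFn, h1]), if_neg h1]
  by_cases h2 : thas T = true
  · rw [iteFn_apply_true (by simp [hasTestFn, h2]), if_pos h2]; rfl
  rw [iteFn_apply_false (by simpa [hasTestFn] using h2), if_neg h2]
  by_cases h3 : dimOf x ≤ tlen T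
  · rw [iteFn_apply_true (by simp [doneTestFn, h3]), if_pos h3]; rfl
  rw [iteFn_apply_false (by simp [doneTestFn, h3]), if_neg h3]
  simp only [qFn, boolUnpair_boolPair]
  rfl

end Literature.Algebra.EuclideanLattices.GMSSMachine


/-! ## The discharge -/

namespace Literature.Algebra.EuclideanLattices

open _root_.Computability Literature.Computability.Complexity

/-- **The step function of the GMSS oracle algorithm is polynomial-time** (`gmssAlg_isPolyTime`,
DISCHARGED): the string function `GMSSMachine.gFn ∈ FP` computes the code of `gmssAlg.step` on
the code of every pair (input, transcript). [cite: MicciancioRegev2007, Lemma 5.22 (authors' version p. 27); AroraBarak2009 §1.3] -/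
theorem gmssAlg_isPolyTime_holds : gmssAlg_isPolyTime :=
  GMSSMachine.gFn_mem_FP.of_encode
    (fun p : List Bool × List (List Bool) => boolPair p.1 ((encodingList Bool).listBool.encode p.2))
    (fun _ => rfl) fun p => by
      rw [Function.uncurry, gmssAlg_step]
      exact GMSSMachine.gFn_boolPair p.1 _

/-- **Micciancio–Regev 2007, Lemma 5.22 / GMSS 1999 Thm. 1 as a Cook reduction of promise
problems, with no remaining hypothesis**: for every factor `γ` and every set `T` of dimensions,
`GapSVP_γ` restricted to dimensions in `T` Cook-reduces (Goldreich 2006, Def. 3) to `GapCVP′_γ`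
restricted to `T`. [cite: MicciancioRegev2007, Lemma 5.22 (authors' version p. 27); Goldreich2006 §1.2 Def. 3] -/
theorem gapSVP_cookReducible_gapCVP'_holds (γ : ℕ → ℝ) (T : Set ℕ) :
    (PromiseProblem.ofEncoding Literature.Algebra.EuclideanLattices.gapSVPInstanceEncoding
        {p | p ∈ Literature.Algebra.EuclideanLattices.GapSVP.yes γ ∧ p.1.n ∈ T} {p | p ∈ Literature.Algebra.EuclideanLattices.GapSVP.no γ ∧ p.1.n ∈ T}).CookReducible
      (PromiseProblem.ofEncoding Literature.Algebra.EuclideanLattices.gapCVPInstanceEncoding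
        {p | p ∈ Literature.Algebra.EuclideanLattices.GapCVP'.yes γ ∧ p.1.I.n ∈ T} {p | p ∈ Literature.Algebra.EuclideanLattices.GapCVP'.no γ ∧ p.1.I.n ∈ T}) :=
  gapSVP_cookReducible_gapCVP' gmssAlg_isPolyTime_holds γ T

end Literature.Algebra.EuclideanLattices

end
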